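import Literature.AlgebraicGeometry.HodgeTheory.RestrictionImageOfCompactification
import Literature.AlgebraicGeometry.HodgeTheory.RelativeCohomologyMHS
import Literature.AlgebraicGeometry.HodgeTheory.ComplexGysinHodgeType
import Literature.AlgebraicGeometry.HodgeTheory.HodgeFiltrationModelsReductionProofs
import Literature.AlgebraicGeometry.HodgeTheory.ComplexConjugationHolds
import Literature.AlgebraicGeometry.HodgeTheory.GysinKernelProofs
import Literature.NumberTheory.Transcendental.DeRhamTheoremMultiplicative
import Literature.AlgebraicGeometry.HodgeTheory.ProperModificationCohomologySpanning
import Literature.AlgebraicGeometry.HodgeTheory.PullbackVanishingOnSmoothSubscheme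
import Literature.AlgebraicGeometry.Resolution.LogResolutionSmoothProjective
import Literature.AlgebraicGeometry.Motives.HodgeStructureSemisimple
import Literature.AlgebraicTopology.SingularHomology.LocalHomologyCoeffResidueFields
import HarnessLib

/-!
# Voisin II, Prop. 4.23 (the image of restriction is unchanged by a smooth compactification):
# reductions of the named fact `voisin2003_rangeRestrict_eq_of_compactification`

Topic `Literature/AlgebraicGeometry/HodgeTheory`; proof-side companion (theorems only, no
definitions, no named facts — D-0026) of `RestrictionImageOfCompactification.lean`, which names
C. Voisin, *Hodge Theory and Complex Algebraic Geometry II* (2003), **Prop. 4.23** (printed p. 124):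
for `X̄` smooth projective, `j : U ↪ X̄` a Zariski open subset and `Y ⊂ U` a closed smooth projective
subvariety, the restriction maps `Hᵏ(U, ℚ) → Hᵏ(Y, ℚ)` and `Hᵏ(X̄, ℚ) → Hᵏ(Y, ℚ)` have the same
image. The printed proof is three lines ON TOP of Deligne's mixed Hodge theory of the open variety
`U` (Hodge II, Thm. 3.2.5 and Cor. 3.2.17: `Hᵏ(U, ℚ)` carries a mixed Hodge structure, functorial,
with `W_k Hᵏ(U) = Im j^*`) and strictness (Hodge II, Thm. 2.3.5 (iii), PROVED in the tree); the tree
has no mixed Hodge structure on the cohomology of an open variety yet (only the hypothesis structure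
`Motives.MixedHodgeStructureOfPair` and the in-file derivation
`voisin2003_rangeRestrict_eq_of_compactification_of_mixedHodge`). This file records the reductions
of the fact which every geometric proof (Deligne's logarithmic complex on a normal-crossings
compactification; or the `∂∂̄` / "principle of two types" road the tree took for Hodge III 8.2.7 in
`GysinKernelSplitHolds`) starts with:

* `singularCohomology.range_map_le_range_map_descent_of_algebra` — **an inclusion of images
  `Im f^* ⊆ Im g^*` in `Hⁿ(Y; –)` DESCENDS along a field extension `K ⊆ L`** (companion of the
  tree's ascent `range_map_le_range_map_of_algebra`): over a field it is `ker g_* ⊆ ker f_*` on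
  homology (`range_singularCohomology_map_le_iff_of_field`, Hatcher §3.1: `f^*` is the transpose of
  `f_*`), and that descends because `Hₙ(Y; K) → Hₙ(Y; L)` is injective and natural
  (`clocalHomology.coeffMap_algebraMap_injective`, `coeffMap_map_apply`; Hatcher §3.A:
  `Hₙ(–; L) = Hₙ(–; K) ⊗_K L`);
* `voisin2003_rangeRestrict_eq_of_compactification_of_complex` — **the named fact follows from the
  one non-trivial inclusion `Im(ι^*) ⊆ Im((ι ≫ i)^*)` on the `ℂ`-carriers `Hᵏ(–(ℂ); ℂ)`**
  (`complexBetti`), the form in which the tree's Kähler / de Rham machinery speaks; the other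
  inclusion is functoriality (`range_map_comp_le`).
* `range_complexBetti_map_le_of_irreducible` — **`𝒳̄` may be taken to be a smooth projective
  VARIETY** (geometrically irreducible): the components of the smooth `𝒳̄` are clopen smooth
  projective varieties, the variety `Y` lands in one of them, and restriction of cohomology to a
  clopen piece is onto.
* `range_complexBetti_map_le_of_snc` — **an irreducible `𝒳̄` may be replaced by a log resolution
  `X' → 𝒳̄` of `𝒳̄ ∖ 𝒳`** (Kollár 2007, Thm. 3.21, the tree's
  `Resolution.exists_logResolution_isSmoothProjective`), whose boundary has simple normal crossings:
  the pure part `Im(Hᵏ(X̄) → Hᵏ(U))` does not depend on the smooth compactification (the tree's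
  `exists_restrictCompl_sub_map_eq_zero_of_isIso_restrict`, Voisin I, proof of Thm. 7.31; Deligne,
  Hodge II, 3.2.11 / Cor. 3.2.17).
* `voisin2003_rangeRestrict_eq_of_compactification_of_snc` — **assembly: the named fact from its
  simple-normal-crossings core** `hSNC` (the inclusion for `Y →ι 𝒳 →i X'` with `X'` a smooth
  projective variety and `X' ∖ i(𝒳) = ⋃ⱼ V(Dⱼ)` an snc boundary with smooth strata) — the exact
  setting of Deligne's logarithmic de Rham complex, which is what remains to be formalised for the
  discharge `voisin2003_rangeRestrict_eq_of_compactification_holds`.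
* `range_le_range_of_hodgeType_span_gr` — **the Hodge-theoretic mechanism of the printed proof in
  the weak form the snc case needs** (abstract pure Hodge structures): the image of a filtered map
  `φ : V → H_Y` into a pure Hodge structure of weight `k` lies in the image of a morphism
  `f : H_X → H_Y` as soon as `φ(W_k) ⊆ im f`, `φ(F^p) ⊆ F^p`, and the graded pieces `W_m/W_{m-1}`,
  `m > k`, are spanned by vectors of Hodge type `(p, m-p)` — strictness (Deligne, Hodge II,
  Thm. 2.3.5 (iii)) unwound to what it uses.
* `hodgeType_span_gr_of_residue_lifts`, `range_le_range_of_residue_lifts` — **the complement of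
  ONE smooth divisor** (two-step weight filtration `W_k = ker Res ⊆ W_{k+1} = Hᵏ(U)` by the
  residue of the Thom–Gysin sequence, Voisin II §6.1.1): the spanning hypothesis, hence
  Prop. 4.23, from four inputs — Thom–Gysin exactness, `Im Res` a sub-Hodge structure of
  `H^{k-1}(D)(-1)`, `F`-compatibility of `ι^*`, and liftability of `F^p`-residues inside `F^p`
  (Deligne's `∂∂̄` step).
* `ker_comp_le_ker_of_hodgeType_vanishing` — **the transposed (Gysin) form** (Deligne, Hodge III,
  8.2.8: Prop. 4.23 is, by Poincaré–Lefschetz duality, `ker (ι ≫ j)_! ⊆ ker ι_!` for the Gysin map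
  with supports `ι_! : H(Y) → H_c(U) = H(X̄, D)`): from the type shift of `ι_!`, `ker (ι ≫ j)_!` a
  sub-Hodge structure, and the vanishing of Hodge-type vectors of total weight `m` inside
  `ker (H^m(X̄, D) → H^m(X̄))` — the statement a "principle of two types" proof would supply;
  `SubHodgeStructure.le_ker_of_piece` — a real map killing the Hodge components of a sub-Hodge
  structure kills it (reduction of the transposed form to classes of pure type).
* `voisin2003_rangeRestrict_eq_of_compactification_of_homology` — the snc core in HOMOLOGICAL form
  over `ℚ` ("a `k`-cycle of `Y(ℂ)` bounding in `X̄(ℂ)` bounds in `U(ℂ)`": `ker (ι ≫ i)_* ⊆ ker ι_*`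
  on `H_k(Y(ℂ); ℚ)`) implies the named fact (cohomology/homology duality over a field and
  `ℚ ↦ ℂ`).
* `voisin2003_rangeRestrict_eq_of_compactification_of_pureType` — the homological snc core needs
  checking only on Poincaré duals `u ⌢ [Y(ℂ)]` of classes `u` of PURE Hodge type (Poincaré
  duality on `Y(ℂ)`, Hodge decomposition of `Y`, bidegree of the Gysin morphism `(ι ≫ i)_*` and
  independence of the Hodge pieces of `X'` — all theorems of the tree);
  `voisin2003_rangeRestrict_eq_of_compactification_of_periods` — the same with the homological
  conclusion replaced by the vanishing of the periods `⟨u ∪ ι^* α, [Y(ℂ)]⟩`, `α ∈ Hᵏ(𝒳(ℂ); ℂ)`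
  (universal coefficients over `ℂ`).

## References

* [VoisinHodgeII2003] C. Voisin, Hodge Theory and Complex Algebraic Geometry II, CUP 2003, §4.3.3,
  Prop. 4.23 (p. 124).
* [DeligneHodgeII1971] P. Deligne, Théorie de Hodge II, Publ. Math. IHÉS 40 (1971), 3.2.11,
  Thm. 3.2.5, Cor. 3.2.17, Thm. 2.3.5 (iii).
* [VoisinHodgeI2002] C. Voisin, Hodge Theory and Complex Algebraic Geometry I, CUP 2002, Thm. 7.31
  (proof).
* [Kollar2007] J. Kollár, Lectures on Resolution of Singularities, PUP 2007, Thm. 3.21 (p. 124), 3.24.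
* [GortzWedhorn2020] U. Görtz, T. Wedhorn, Algebraic Geometry I, 2nd ed. (2020), Exercise 3.16.
* [HatcherAT2002] A. Hatcher, Algebraic Topology, CUP 2002, §3.1 Thm. 3.2 (p. 195), p. 201,
  pp. 203–204, §3.A Lemma 3A.1, Cor. 3A.4.
-/

noncomputable section

-- as in `GlobalInvariantCyclesCoefficientsProofs` / `LocalHomologyCoeffChange`: chains of the
-- concrete complex are `Finsupp`s up to unfolding
set_option backward.isDefEq.respectTransparency false

open CategoryTheory

universe u v

/-! ### Descent of `Im f^* ⊆ Im g^*` along a field extension -/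

namespace Literature.AlgebraicTopology.SingularHomology

section Descent

variable (K : Type v) {L : Type v} [Field K] [Field L] [Algebra K L]
variable {X Y T : Type u} [TopologicalSpace X] [TopologicalSpace Y] [TopologicalSpace T]

/-- **Vanishing under `f_*` modulo vanishing under `g_*` descends along field extensions**
(concrete local homology): if over `L ⊇ K` every class killed by `g_*` is killed by `f_*`, the same
holds over `K` — extend the coefficients of a `K`-class (`coeffMap` along `K → L`, natural in maps
of pairs: `coeffMap_map_apply`) and use that this extension is injective
(`coeffMap_algebraMap_injective`: the `K`-linear map `K → L` has a `K`-linear retraction).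
[cite: HatcherAT2002, §3.A Lemma 3A.1 and Cor. 3A.4] -/
theorem clocalHomology.map_eq_zero_descent_of_algebra {A₀ : Set X} {B : Set Y} {C : Set T}
    (f : C(Y, X)) (g : C(Y, T)) (hf : Set.MapsTo f Bᶜ A₀ᶜ) (hg : Set.MapsTo g Bᶜ Cᶜ) (i : ℕ)
    (hL : ∀ a : clocalHomology L L Y B i,
      clocalHomology.map L L g hg i a = 0 → clocalHomology.map L L f hf i a = 0)
    (a : clocalHomology K K Y B i) (ha : clocalHomology.map K K g hg i a = 0) :
    clocalHomology.map K K f hf i a = 0 := by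
  apply clocalHomology.coeffMap_algebraMap_injective K L A₀ i
  rw [map_zero]
  change clocalHomology.coeffMap K L (Algebra.linearMap K L).toAddMonoidHom A₀ i
    (clocalHomology.map K K f hf i a) = 0
  rw [clocalHomology.coeffMap_map_apply]
  refine hL _ ?_
  rw [← clocalHomology.coeffMap_map_apply, ha, map_zero]

/-- **`ker g_* ⊆ ker f_*` descends along field extensions** (singular homology): for continuous
`f : Y → X`, `g : Y → T` and fields `K ⊆ L`, if `ker(g_*) ⊆ ker(f_*)` on `Hₙ(Y; L)` then
`ker(g_*) ⊆ ker(f_*)` on `Hₙ(Y; K)` (Hatcher 2002, §3.A: `Hₙ(–; L) = Hₙ(–; K) ⊗_K L` naturally and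
`K → L` is faithfully flat; here via the concrete model, `clocalHomology.map_eq_zero_descent_of_algebra`).
[cite: HatcherAT2002, §3.A Lemma 3A.1 and Cor. 3A.4] -/
theorem singularHomology.ker_map_le_ker_map_descent_of_algebra (f : C(Y, X)) (g : C(Y, T)) (n : ℕ)
    (hL : LinearMap.ker (singularHomology.map L L g n).hom ≤
      LinearMap.ker (singularHomology.map L L f n).hom) :
    LinearMap.ker (singularHomology.map K K g n).hom ≤
      LinearMap.ker (singularHomology.map K K f n).hom := by
  intro c hc
  rw [LinearMap.mem_ker] at hc ⊢
  change singularHomology.map K K f n c = 0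
  change singularHomology.map K K g n c = 0 at hc
  apply (bijective_homologyMap_π_compIso_inv K K (X := X) n).1
  change HomologicalComplex.homologyMap (awaySub K K X Set.univ).π n
      ((csingularHomology.compIso K K X n).inv (singularHomology.map K K f n c)) =
    HomologicalComplex.homologyMap (awaySub K K X Set.univ).π n
      ((csingularHomology.compIso K K X n).inv 0)
  rw [map_zero, map_zero, homologyMap_π_compIso_inv_map]
  refine clocalHomology.map_eq_zero_descent_of_algebra K (L := L) f g (mapsTo_compl_univ f)
    (mapsTo_compl_univ g) n ?_ _ ?_
  · intro a ha
    obtain ⟨a₀, rfl⟩ := (bijective_homologyMap_π_compIso_inv L L (X := Y) n).2 a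
    beta_reduce at ha ⊢
    rw [← homologyMap_π_compIso_inv_map] at ha ⊢
    have hg0 : singularHomology.map L L g n a₀ = 0 := by
      apply (bijective_homologyMap_π_compIso_inv L L (X := T) n).1
      beta_reduce
      rw [ha, map_zero, map_zero]
    have hf0 : singularHomology.map L L f n a₀ = 0 :=
      LinearMap.mem_ker.1 (hL (LinearMap.mem_ker.2 hg0))
    rw [hf0, map_zero, map_zero]
  · rw [← homologyMap_π_compIso_inv_map, hc, map_zero, map_zero]

/-- **`Im f^* ⊆ Im g^*` descends along field extensions** (singular cohomology): for continuous
`f : Y → X`, `g : Y → T` and fields `K ⊆ L`, if `Im(f^* : Hⁿ(X; L) → Hⁿ(Y; L)) ⊆ Im(g^*)` then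
`Im(f^* : Hⁿ(X; K) → Hⁿ(Y; K)) ⊆ Im(g^*)` — over each field this is `ker g_* ⊆ ker f_*`
(`range_singularCohomology_map_le_iff_of_field`), which descends
(`singularHomology.ker_map_le_ker_map_descent_of_algebra`). With the tree's ascent
`range_map_le_range_map_of_algebra` the two inclusions are equivalent ("`Hⁿ(–; L) = Hⁿ(–; K) ⊗_K L`").
[cite: HatcherAT2002, §3.1 Thm. 3.2 (p. 195) and §3.A Cor. 3A.4] -/
theorem singularCohomology.range_map_le_range_map_descent_of_algebra (f : C(Y, X)) (g : C(Y, T))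
    (n : ℕ)
    (hL : LinearMap.range (singularCohomology.map L L f n).hom ≤
      LinearMap.range (singularCohomology.map L L g n).hom) :
    LinearMap.range (singularCohomology.map K K f n).hom ≤
      LinearMap.range (singularCohomology.map K K g n).hom := by
  rw [range_singularCohomology_map_le_iff_of_field] at hL ⊢
  exact singularHomology.ker_map_le_ker_map_descent_of_algebra K f g n hL

/-- `Im f^* ⊆ Im g^*` over `K` iff over `L ⊇ K` (ascent `range_map_le_range_map_of_algebra` and
descent `range_map_le_range_map_descent_of_algebra`). [cite: HatcherAT2002, §3.A Cor. 3A.4] -/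
theorem singularCohomology.range_map_le_range_map_iff_of_algebra (f : C(Y, X)) (g : C(Y, T))
    (n : ℕ) :
    LinearMap.range (singularCohomology.map K K f n).hom ≤
        LinearMap.range (singularCohomology.map K K g n).hom ↔
      LinearMap.range (singularCohomology.map L L f n).hom ≤
        LinearMap.range (singularCohomology.map L L g n).hom :=
  ⟨singularCohomology.range_map_le_range_map_of_algebra K f g n,
    singularCohomology.range_map_le_range_map_descent_of_algebra K f g n⟩

end Descent

end Literature.AlgebraicTopology.SingularHomology

/-! ### Prop. 4.23: the named fact from the non-trivial inclusion on the `ℂ`-carriers -/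

namespace Literature.AlgebraicGeometry.HodgeTheory

open _root_.AlgebraicGeometry
open Literature.AlgebraicTopology.SingularHomology
open Literature.AlgebraicGeometry.Motives

section Schemes

variable {𝒳 Xbar Y : Motives.SchemeOver ℂ}

/-- The trivial inclusion of Prop. 4.23, `Im((ι ≫ i)^*) ⊆ Im(ι^*)` on `Hᵏ(–(ℂ); ℚ)`: functoriality
`(ι ≫ i)^* = ι^* ∘ i^*` (`SchemePair.Hom.ofScheme_comp`, `bettiCohomology.map_comp`). [folklore] -/
theorem range_bettiCohomology_map_comp_le (i : 𝒳 ⟶ Xbar) (ι : Y ⟶ 𝒳) (k : ℕ) :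
    LinearMap.range (SchemePair.bettiCohomology.map (SchemePair.Hom.ofScheme (ι ≫ i)) k).hom ≤
      LinearMap.range (SchemePair.bettiCohomology.map (SchemePair.Hom.ofScheme ι) k).hom := by
  rintro _ ⟨A, rfl⟩
  rw [SchemePair.Hom.ofScheme_comp, SchemePair.bettiCohomology.map_comp, ModuleCat.comp_apply]
  exact ⟨_, rfl⟩

/-- **Transport of `Im(ι^*) ⊆ Im((ι ≫ i)^*)` from `Hᵏ(–(ℂ); ℂ)` to `Hᵏ(–(ℂ); ℚ)`.** For `ℂ`-morphisms
`ι : Y ⟶ 𝒳`, `i : 𝒳 ⟶ 𝒳̄`: if every class of `Hᵏ(𝒳(ℂ); ℂ)` restricts to `Y` as some class of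
`Hᵏ(𝒳̄(ℂ); ℂ)` does (`complexBetti.map`), then the same holds on the tree's rational carriers
`SchemePair.bettiCohomology (ofScheme –) k = Hᵏ(–(ℂ); ℚ)` — descent of the inclusion of images along
`ℚ ⊆ ℂ` (`range_map_le_range_map_descent_of_algebra`) and naturality of
`Hᵏ((X, ∅)) ≅ Hᵏ(X(ℂ); ℚ)` (`absIso_hom_map_ofScheme`). [cite: HatcherAT2002, §3.A Cor. 3A.4] -/
theorem range_bettiCohomology_map_le_of_complex (i : 𝒳 ⟶ Xbar) (ι : Y ⟶ 𝒳) (k : ℕ)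
    (hC : LinearMap.range (complexBetti.map ι k).hom ≤
      LinearMap.range (complexBetti.map (ι ≫ i) k).hom) :
    LinearMap.range (SchemePair.bettiCohomology.map (SchemePair.Hom.ofScheme ι) k).hom ≤
      LinearMap.range (SchemePair.bettiCohomology.map (SchemePair.Hom.ofScheme (ι ≫ i)) k).hom := by
  have hQ : LinearMap.range (singularCohomology.map ℚ ℚ
        (Motives.AlgPoints.mapContinuous (L := ℂ) ι) k).hom ≤
      LinearMap.range (singularCohomology.map ℚ ℚ
        (Motives.AlgPoints.mapContinuous (L := ℂ) (ι ≫ i)) k).hom :=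
    singularCohomology.range_map_le_range_map_descent_of_algebra ℚ (L := ℂ) _ _ k hC
  rintro _ ⟨β, rfl⟩
  obtain ⟨A', hA'⟩ := hQ ⟨(SchemePair.absIso 𝒳 k).hom β, rfl⟩
  refine ⟨(SchemePair.absIso Xbar k).inv A', ?_⟩
  apply ((SchemePair.absIso Y k).toLinearEquiv).injective
  change (SchemePair.absIso Y k).hom _ = (SchemePair.absIso Y k).hom _
  rw [absIso_hom_map_ofScheme (ι ≫ i) k, absIso_hom_map_ofScheme ι k,
    ← ModuleCat.comp_apply (SchemePair.absIso Xbar k).inv, Iso.inv_hom_id, ModuleCat.id_apply]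
  exact hA'

end Schemes

/-- **Voisin II, Prop. 4.23 from its `ℂ`-coefficient core.** The named fact
`voisin2003_rangeRestrict_eq_of_compactification` (equality of the images of
`Hᵏ(𝒳̄(ℂ); ℚ) → Hᵏ(Y(ℂ); ℚ)` and `Hᵏ(𝒳(ℂ); ℚ) → Hᵏ(Y(ℂ); ℚ)` for `Y ⊂ 𝒳 ⊂ 𝒳̄`, `Y` smooth projective
closed in the open subscheme `𝒳` of the smooth projective `𝒳̄`) follows from the single inclusion
`Im(ι^* : Hᵏ(𝒳(ℂ); ℂ) → Hᵏ(Y(ℂ); ℂ)) ⊆ Im((ι ≫ i)^*)` with COMPLEX coefficients, under the same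
hypotheses: the reverse inclusion is functoriality (`range_bettiCohomology_map_comp_le`) and
`ℚ`-coefficients follow by faithfully flat descent `Hᵏ(–; ℂ) = Hᵏ(–; ℚ) ⊗ ℂ`
(`range_bettiCohomology_map_le_of_complex`). This is the form in which a Hodge-theoretic proof
(Deligne, Hodge II §3.2: logarithmic de Rham complex of a normal-crossings compactification,
`W_k Hᵏ(U) = Im Hᵏ(X̄)`, strictness) delivers the statement. [cite: VoisinHodgeII2003, Prop. 4.23]
[cite: DeligneHodgeII1971, Cor. 3.2.17] [cite: HatcherAT2002, §3.A Cor. 3A.4] -/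
theorem voisin2003_rangeRestrict_eq_of_compactification_of_complex
    (hC : ∀ (𝒳 Xbar Y : Motives.SchemeOver ℂ) (i : 𝒳 ⟶ Xbar) (ι : Y ⟶ 𝒳) (m n : ℕ),
      Motives.IsProjectiveOver Xbar → SmoothOfRelativeDimension m Xbar.hom →
      IsOpenImmersion i.left → Motives.IsSmoothProjective n Y → IsClosedImmersion ι.left →
      ∀ k : ℕ, LinearMap.range (complexBetti.map ι k).hom ≤
        LinearMap.range (complexBetti.map (ι ≫ i) k).hom) :
    voisin2003_rangeRestrict_eq_of_compactification := by
  intro 𝒳 Xbar Y i ι m n hXbar hXs hi hY hι k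
  exact le_antisymm (range_bettiCohomology_map_comp_le i ι k)
    (range_bettiCohomology_map_le_of_complex i ι k (hC 𝒳 Xbar Y i ι m n hXbar hXs hi hY hι k))

/-! ### Reduction to an irreducible compactification with simple-normal-crossings boundary

Every geometric proof of Prop. 4.23 (Deligne's, through the logarithmic de Rham complex
`Ω•_{X̄}(log D)`; Hodge II §3.2) is run on a compactification `X̄` of `U` whose boundary `X̄ ∖ U` is a
divisor with (simple) normal crossings, reached from an arbitrary smooth projective `X̄` by
Hironaka's embedded resolution; Deligne then transfers the conclusion to all smooth
compactifications (Cor. 3.2.17: the pure part `W_k Hᵏ(U) = Im Hᵏ(X̄)` does not depend on `X̄`). Both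
steps are theorems of the tree: the log resolution of a closed subset of a smooth projective
variety (`Resolution.exists_logResolution_isSmoothProjective`, Kollár 2007, Thm. 3.21) and the
transfer of the pure part along a proper modification
(`exists_restrictCompl_sub_map_eq_zero_of_isIso_restrict`, Voisin I, proof of Thm. 7.31: degree one
and excision). This section performs the reduction: the named fact follows from its special case
in which `𝒳̄` is a smooth projective VARIETY (geometrically irreducible, `Motives.IsSmoothProjective`)
and the complement of the open `𝒳` is the union of the members `V(D_j)` of a simple normal
crossings boundary, all of whose strata `V(Σ_{j ∈ I} D_j)` are smooth of dimension `dim 𝒳̄ - |I|`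
(`voisin2003_rangeRestrict_eq_of_compactification_of_snc`). -/

section SNC

variable {𝒳 Xbar Y : Motives.SchemeOver ℂ}

/-- A class on `X'(ℂ)` which dies on the complex points over the complement of `S ⊆ X'` pulls back
to zero along every morphism `g : Y ⟶ X'` avoiding `S` (the continuous map `g(ℂ)` factors through
that open subspace). Local copy of the lemma of the same name in `FermatLinearSubspaceComplexPoints`
(not imported here). [folklore] -/
private theorem complexBetti_map_eq_zero_of_forall_notMem {X' : Motives.SchemeOver ℂ} (g : Y ⟶ X')
    (S : Set X'.left) (hg : ∀ y : Y.left, g.left.base y ∉ S) {k : ℕ} {w : complexBetti X' k}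
    (hw : complexBetti.restrictCompl X' S k w = 0) : complexBetti.map g k w = 0 := by
  let c : C(Motives.ComplexPoints Y, Motives.complexPointsCompl X' S) :=
    ⟨fun Q ↦ ⟨Motives.AlgPoints.map g Q, hg Q.pt⟩,
      (Motives.AlgPoints.continuous_map (L := ℂ) g).subtype_mk _⟩
  have hfac : Motives.AlgPoints.mapContinuous (L := ℂ) g =
      (⟨Subtype.val, continuous_subtype_val⟩ :
        C(Motives.complexPointsCompl X' S, Motives.ComplexPoints X')).comp c := by
    ext Q
    rfl
  change singularCohomology.map ℂ ℂ (Motives.AlgPoints.mapContinuous (L := ℂ) g) k w = 0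
  rw [hfac, singularCohomology.map_comp, ModuleCat.comp_apply]
  change singularCohomology.map ℂ ℂ c k (complexBetti.restrictCompl X' S k w) = 0
  rw [hw, map_zero]

/-- **Prop. 4.23 for a smooth projective variety `𝒳̄` from the simple-normal-crossings case.**
Assume the inclusion `Im(ι^*) ⊆ Im((ι ≫ i)^*)` on `Hᵏ(–(ℂ); ℂ)` for all `Y →ι 𝒳 →i X'` with `X'` a
smooth projective variety, `i` an open immersion whose complement is the union `⋃ⱼ V(Dⱼ)` of an
injective finite family of ideal sheaves all of whose strata `V(Σ_{j∈I} Dⱼ)` are smooth of relative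
dimension `dim X' - |I|` (a simple normal crossings boundary), and `ι` a closed immersion from a
smooth projective variety (`hSNC`). Then the inclusion holds for every smooth projective VARIETY
`𝒳̄`: let `Z = 𝒳̄ ∖ i(𝒳)` (closed, and `≠ 𝒳̄` since the variety `Y` is non-empty); Kollár's log
resolution `σ : X' → 𝒳̄` of `Z` (`Resolution.exists_logResolution_isSmoothProjective`) is an
isomorphism over `U = i(𝒳)` with `σ⁻¹Z` an snc boundary, so `i` lifts to an open immersion
`i' : 𝒳 ≅ U ≅ σ⁻¹U ↪ X'` with complement `σ⁻¹Z`, and `hSNC` gives `Im(ι^*) ⊆ Im((ι ≫ i')^*)`; finally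
every class `β'` of `Hᵏ(X'(ℂ); ℂ)` agrees over `σ⁻¹U ⊇ i'(ι(Y))` with `σ^* y` for some
`y ∈ Hᵏ(𝒳̄(ℂ); ℂ)` (`exists_restrictCompl_sub_map_eq_zero_of_isIso_restrict`: `σ` has degree one),
whence `(ι ≫ i')^* β' = (ι ≫ i)^* y`. [cite: VoisinHodgeII2003, Prop. 4.23]
[cite: DeligneHodgeII1971, 3.2.11 and Cor. 3.2.17] [cite: Kollar2007, Thm. 3.21 (p. 124)]
[cite: VoisinHodgeI2002, Thm. 7.31 (proof)] -/
theorem range_complexBetti_map_le_of_snc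
    (hSNC : ∀ (𝒳 X' Y : Motives.SchemeOver ℂ) (i : 𝒳 ⟶ X') (ι : Y ⟶ 𝒳) (m n r : ℕ)
      (D : Fin r → X'.left.IdealSheafData),
      Motives.IsSmoothProjective m X' → IsOpenImmersion i.left → Motives.IsSmoothProjective n Y →
      IsClosedImmersion ι.left → Function.Injective D →
      (∀ I : Finset (Fin r),
        SmoothOfRelativeDimension (m - I.card) ((⨆ j ∈ I, D j).subschemeι ≫ X'.hom)) →
      (Set.range i.left.base)ᶜ = ⋃ j, ((D j).support : Set X'.left) →
      ∀ k : ℕ, LinearMap.range (complexBetti.map ι k).hom ≤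
        LinearMap.range (complexBetti.map (ι ≫ i) k).hom)
    {m n : ℕ} (hXbar : Motives.IsSmoothProjective m Xbar) (i : 𝒳 ⟶ Xbar) [IsOpenImmersion i.left]
    (ι : Y ⟶ 𝒳) (hY : Motives.IsSmoothProjective n Y) [IsClosedImmersion ι.left] (k : ℕ) :
    LinearMap.range (complexBetti.map ι k).hom ≤
      LinearMap.range (complexBetti.map (ι ≫ i) k).hom := by
  -- the open `U = i(𝒳)` and its closed complement `Z`
  set U : Xbar.left.Opens := i.left.opensRange with hUdef
  have hZ : IsClosed ((U : Set Xbar.left)ᶜ) := U.2.isClosed_compl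
  -- `Z ≠ 𝒳̄`: the variety `Y` is non-empty and maps into `U`
  haveI : IsIntegral Y.left := Motives.IsSmoothProjective.isIntegral_holds hY
  have hZne : (U : Set Xbar.left)ᶜ ≠ Set.univ := by
    intro h
    obtain ⟨y⟩ := (inferInstance : Nonempty Y.left)
    have hy : i.left.base (ι.left.base y) ∈ (U : Set Xbar.left) := ⟨ι.left.base y, rfl⟩
    have hy' : i.left.base (ι.left.base y) ∈ (U : Set Xbar.left)ᶜ := by
      rw [h]; trivial
    exact hy' hy
  -- Kollár's log resolution of `Z`
  obtain ⟨X', σ, r, D, hX', hbir, hiso, hDinj, hstrata, hpre⟩ :=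
    Resolution.exists_logResolution_isSmoothProjective hXbar hZ hZne
  have hUeq : (⟨((U : Set Xbar.left)ᶜ)ᶜ, hZ.isOpen_compl⟩ : Xbar.left.Opens) = U :=
    TopologicalSpace.Opens.ext (compl_compl _)
  haveI hisoU : IsIso (σ.left ∣_ U) := by
    have htr : ∀ W : Xbar.left.Opens, W = U → IsIso (σ.left ∣_ W) → IsIso (σ.left ∣_ U) := by
      rintro W rfl h
      exact h
    exact htr _ hUeq hiso
  -- the lift `i' : 𝒳 ≅ U ≅ σ⁻¹U ↪ X'` of `i`
  set a : 𝒳.left ⟶ (σ.left ⁻¹ᵁ U : X'.left.Opens) :=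
    i.left.isoOpensRange.hom ≫ inv (σ.left ∣_ U) with ha
  haveI : IsIso a := by rw [ha]; infer_instance
  set i'l : 𝒳.left ⟶ X'.left := a ≫ (σ.left ⁻¹ᵁ U).ι with hi'l
  have hi'σ : i'l ≫ σ.left = i.left := by
    rw [hi'l, ha, Category.assoc, Category.assoc, ← morphismRestrict_ι, IsIso.inv_hom_id_assoc]
    exact i.left.isoOpensRange_hom_ι
  set i' : 𝒳 ⟶ X' := Over.homMk i'l (by
    change i'l ≫ X'.hom = 𝒳.hom
    rw [← Over.w σ, ← Category.assoc, hi'σ]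
    exact Over.w i) with hi'def
  have hi'left : i'.left = i'l := rfl
  have hi'σ' : i' ≫ σ = i := by
    ext1
    rw [Over.comp_left, hi'left, hi'σ]
  haveI : IsOpenImmersion i'.left := by
    rw [hi'left, hi'l]
    infer_instance
  -- the range of `i'` is `σ⁻¹U`, its complement the snc boundary `σ⁻¹Z`
  have hrange : Set.range i'.left.base = ((σ.left ⁻¹ᵁ U : X'.left.Opens) : Set X'.left) := by
    have hsurj : Function.Surjective (⇑a : 𝒳.left → _) := (Scheme.homeoOfIso (asIso a)).surjective
    rw [hi'left, hi'l, Scheme.Hom.comp_base, TopCat.coe_comp, Set.range_comp, hsurj.range_eq,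
      Set.image_univ]
    exact Scheme.Opens.range_ι _
  have hcompl : (Set.range i'.left.base)ᶜ = ⋃ j, ((D j).support : Set X'.left) := by
    rw [hrange, ← hpre]
    rfl
  -- the snc case for `Y →ι 𝒳 →i' X'`
  have h1 := hSNC 𝒳 X' Y i' ι m n r D hX' inferInstance hY inferInstance hDinj hstrata hcompl k
  refine h1.trans ?_
  rintro _ ⟨β', rfl⟩
  -- transfer down `σ`: `β'` agrees with some `σ^* y` over `σ⁻¹U`
  obtain ⟨y, hy⟩ := exists_restrictCompl_sub_map_eq_zero_of_isIso_restrict hX' hXbar σ hbir U k β'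
  refine ⟨y, ?_⟩
  have hvan : complexBetti.map (ι ≫ i') k (β' - complexBetti.map σ k y) = 0 := by
    refine complexBetti_map_eq_zero_of_forall_notMem (ι ≫ i')
      (((σ.left ⁻¹ᵁ U : X'.left.Opens) : Set X'.left)ᶜ) (fun y₀ ↦ Set.notMem_compl_iff.mpr ?_) hy
    rw [← hrange, Over.comp_left, Scheme.Hom.comp_base, TopCat.coe_comp]
    exact ⟨ι.left.base y₀, rfl⟩
  rw [map_sub, sub_eq_zero] at hvan
  have hfac : ι ≫ i = (ι ≫ i') ≫ σ := by rw [Category.assoc, hi'σ']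
  change complexBetti.map (ι ≫ i) k y = complexBetti.map (ι ≫ i') k β'
  rw [hvan, hfac, complexBetti.map_comp, ModuleCat.comp_apply]

/-- **Prop. 4.23 for an arbitrary smooth projective `𝒳̄` from the case of a smooth projective
VARIETY.** If `Im(ι^*) ⊆ Im((ι ≫ i)^*)` on `Hᵏ(–(ℂ); ℂ)` holds whenever the compactification is a
smooth projective variety (geometrically irreducible; `hIrr`), it holds for every `𝒳̄` projective
and smooth of pure dimension `m` over `ℂ` (possibly disconnected): the irreducible components of
`𝒳̄` are open (its local rings are domains, `isOpen_of_mem_irreducibleComponents_of_isDomain_stalk`),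
pairwise disjoint, each a smooth projective variety `X₀`; the variety `Y` (irreducible) maps into
one of them, `X₀ ⊇ i(ι(Y))`, so `ι` factors through the open piece `𝒳₀ = i⁻¹X₀` by a closed
immersion `ι₀` (`IsClosedImmersion.of_comp`), `hIrr` applies to `Y →ι₀ 𝒳₀ →i₀ X₀`, and restriction
`Hᵏ(𝒳̄(ℂ)) → Hᵏ(X₀(ℂ))` to the clopen piece `X₀(ℂ)` is surjective
(`singularCohomology.map_surjective_of_isEmbedding_of_isClopen`). [cite: VoisinHodgeII2003, Prop. 4.23]
[cite: GortzWedhorn2020, Exercise 3.16 (p. 117)] [cite: HatcherAT2002, §3.1 pp. 203–204] -/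
theorem range_complexBetti_map_le_of_irreducible
    (hIrr : ∀ (𝒳 Xbar Y : Motives.SchemeOver ℂ) (i : 𝒳 ⟶ Xbar) (ι : Y ⟶ 𝒳) (m n : ℕ),
      Motives.IsSmoothProjective m Xbar → IsOpenImmersion i.left → Motives.IsSmoothProjective n Y →
      IsClosedImmersion ι.left →
      ∀ k : ℕ, LinearMap.range (complexBetti.map ι k).hom ≤
        LinearMap.range (complexBetti.map (ι ≫ i) k).hom)
    {m n : ℕ} (hXbar : Motives.IsProjectiveOver Xbar) [SmoothOfRelativeDimension m Xbar.hom]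
    (i : 𝒳 ⟶ Xbar) [IsOpenImmersion i.left] (ι : Y ⟶ 𝒳) (hY : Motives.IsSmoothProjective n Y)
    [IsClosedImmersion ι.left] (k : ℕ) :
    LinearMap.range (complexBetti.map ι k).hom ≤
      LinearMap.range (complexBetti.map (ι ≫ i) k).hom := by
  -- `𝒳̄` is locally Noetherian with integral local rings: its components are open and closed
  haveI : IsProper Xbar.hom := hXbar.isProper
  haveI : IsLocallyNoetherian Xbar.left := LocallyOfFiniteType.isLocallyNoetherian Xbar.hom
  have hdom : ∀ x : Xbar.left, IsDomain (Xbar.left.presheaf.stalk x) := fun x ↦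
    Motives.isDomain_stalk_of_smoothOfRelativeDimension Xbar.hom m x
  haveI : IsReduced Xbar.left := Motives.isReduced_of_smoothOfRelativeDimension Xbar.hom m
  -- a point of the variety `Y` and the component `Z₀` of `𝒳̄` through its image
  haveI : IsIntegral Y.left := Motives.IsSmoothProjective.isIntegral_holds hY
  obtain ⟨y₀⟩ := (inferInstance : Nonempty Y.left)
  set x₀ : Xbar.left := i.left.base (ι.left.base y₀) with hx₀
  set Z₀ : Set Xbar.left := irreducibleComponent x₀ with hZ₀def
  have hZ₀ : Z₀ ∈ irreducibleComponents Xbar.left := irreducibleComponent_mem_irreducibleComponents x₀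
  have hZ₀o : IsOpen Z₀ := isOpen_of_mem_irreducibleComponents_of_isDomain_stalk hdom hZ₀
  have hZ₀c : IsClosed Z₀ := isClosed_of_mem_irreducibleComponents _ hZ₀
  set W₀ : Xbar.left.Opens := ⟨Z₀, hZ₀o⟩ with hW₀
  -- `i(ι(Y)) ⊆ Z₀`: an irreducible set meeting the open and closed `Z₀`
  have hYZ : ∀ y : Y.left, i.left.base (ι.left.base y) ∈ Z₀ := by
    have hirr : IsIrreducible ((fun y : Y.left ↦ i.left.base (ι.left.base y)) '' Set.univ) :=
      (IrreducibleSpace.isIrreducible_univ _).image _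
        (i.left.continuous.comp ι.left.continuous).continuousOn
    rw [Set.image_univ] at hirr
    have h1 := subset_closure_inter_of_isPreirreducible_of_isOpen hirr.2 hZ₀o
      ⟨x₀, ⟨y₀, rfl⟩, mem_irreducibleComponent⟩
    have h2 : (Set.range fun y : Y.left ↦ i.left.base (ι.left.base y)) ⊆ Z₀ :=
      h1.trans ((closure_mono Set.inter_subset_right).trans hZ₀c.closure_subset)
    exact fun y ↦ h2 ⟨y, rfl⟩
  -- the component as a smooth projective variety `X₀ ↪ 𝒳̄`
  set X₀ : Motives.SchemeOver ℂ := Motives.openSubschemeOver Xbar W₀ with hX₀def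
  set w₀ : X₀ ⟶ Xbar := Motives.openSubschemeOverι Xbar W₀ with hw₀
  haveI hw₀open : IsOpenImmersion w₀.left := inferInstanceAs (IsOpenImmersion W₀.ι)
  have hX₀ : Motives.IsSmoothProjective m X₀ := by
    have hsm : SmoothOfRelativeDimension m X₀.hom :=
      IsZariskiLocalAtSource.comp (P := @SmoothOfRelativeDimension m) ‹_› W₀.ι
    haveI : IsClosedImmersion w₀.left := by
      refine IsClosedImmersion.of_isPreimmersion _ ?_
      change IsClosed (Set.range W₀.ι.base)
      rw [Scheme.Opens.range_ι]
      exact hZ₀c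
    have hproj : Motives.IsProjectiveOver X₀ :=
      Resolution.isProjectiveOver_of_isClosedImmersion_left w₀ hXbar
    haveI : IrreducibleSpace X₀.left := by
      change IrreducibleSpace W₀
      exact Subtype.irreducibleSpace hZ₀.1
    haveI : IsReduced X₀.left := Motives.isReduced_of_smoothOfRelativeDimension X₀.hom m
    haveI : IsIntegral X₀.left := isIntegral_of_irreducibleSpace_of_isReduced _
    haveI := Motives.geometricallyIntegral_of_isAlgClosed X₀.hom
    exact ⟨hsm, hproj, inferInstance⟩
  -- the open piece `𝒳₀ = i⁻¹ X₀` and `i₀ : 𝒳₀ ↪ X₀`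
  set 𝒳₀ : Motives.SchemeOver ℂ := Motives.openSubschemeOver 𝒳 (i.left ⁻¹ᵁ W₀) with h𝒳₀def
  set j₀ : 𝒳₀ ⟶ 𝒳 := Motives.openSubschemeOverι 𝒳 (i.left ⁻¹ᵁ W₀) with hj₀
  set i₀ : 𝒳₀ ⟶ X₀ := Motives.restrictOverHom i W₀ with hi₀
  have hsq : i₀ ≫ w₀ = j₀ ≫ i := Motives.restrictOverHom_comp_openSubschemeOverι i W₀
  haveI hj₀open : IsOpenImmersion j₀.left := inferInstanceAs (IsOpenImmersion (i.left ⁻¹ᵁ W₀).ι)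
  haveI : IsOpenImmersion i₀.left := by
    change IsOpenImmersion (i.left ∣_ W₀)
    exact IsZariskiLocalAtTarget.restrict (P := @IsOpenImmersion) ‹IsOpenImmersion i.left› W₀
  -- the lift `ι₀ : Y ⟶ 𝒳₀` of `ι`, a closed immersion
  have hιrange : Set.range ι.left.base ⊆ Set.range j₀.left.base := by
    rintro _ ⟨y, rfl⟩
    change ι.left.base y ∈ Set.range (i.left ⁻¹ᵁ W₀).ι.base
    rw [Scheme.Opens.range_ι]
    exact hYZ y
  set ι₀l : Y.left ⟶ 𝒳₀.left := IsOpenImmersion.lift j₀.left ι.left hιrange with hι₀l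
  have hι₀fac : ι₀l ≫ j₀.left = ι.left := IsOpenImmersion.lift_fac _ _ _
  set ι₀ : Y ⟶ 𝒳₀ := Over.homMk ι₀l (by
    rw [← Over.w j₀, ← Category.assoc, hι₀fac]
    exact Over.w ι) with hι₀def
  have hι₀left : ι₀.left = ι₀l := rfl
  have hι₀ : ι₀ ≫ j₀ = ι := by
    ext1
    rw [Over.comp_left, hι₀left, hι₀fac]
  haveI : IsClosedImmersion ι₀.left := by
    haveI : IsClosedImmersion (ι₀.left ≫ j₀.left) := by
      rw [hι₀left, hι₀fac]
      infer_instance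
    exact IsClosedImmersion.of_comp ι₀.left j₀.left
  -- the irreducible case for `Y →ι₀ 𝒳₀ →i₀ X₀`
  have h1 := hIrr 𝒳₀ X₀ Y i₀ ι₀ m n hX₀ inferInstance hY inferInstance k
  -- `Im(ι^*) ⊆ Im(ι₀^*)`
  have h0 : LinearMap.range (complexBetti.map ι k).hom ≤
      LinearMap.range (complexBetti.map ι₀ k).hom := by
    rintro _ ⟨b, rfl⟩
    refine ⟨complexBetti.map j₀ k b, ?_⟩
    change complexBetti.map ι₀ k (complexBetti.map j₀ k b) = complexBetti.map ι k b
    rw [← ModuleCat.comp_apply, ← complexBetti.map_comp, hι₀]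
  refine h0.trans (h1.trans ?_)
  -- `Im((ι₀ ≫ i₀)^*) ⊆ Im((ι ≫ i)^*)`: restriction to the clopen piece `X₀(ℂ)` is onto
  have hsurj : Function.Surjective (complexBetti.map w₀ k) := by
    refine singularCohomology.map_surjective_of_isEmbedding_of_isClopen (R := ℂ)
      (Motives.AlgPoints.mapContinuous (L := ℂ) w₀)
      (Motives.AlgPoints.isOpenEmbedding_map_holds (L := ℂ) w₀).isEmbedding ?_ k
    have hr : Set.range (Motives.AlgPoints.mapContinuous (L := ℂ) w₀) =
        {P : Motives.ComplexPoints Xbar | P.pt ∈ Z₀} := by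
      change Set.range (Motives.AlgPoints.map (L := ℂ) w₀) = _
      rw [Motives.AlgPoints.range_map_of_isOpenImmersion_holds (L := ℂ) w₀]
      ext P
      change P.pt ∈ ((W₀.ι.opensRange : Xbar.left.Opens) : Set Xbar.left) ↔ P.pt ∈ Z₀
      rw [Scheme.Opens.opensRange_ι]
      rfl
    rw [hr]
    exact ⟨⟨Motives.AlgPoints.isOpen_setOf_pt_mem (X := Xbar) (L := ℂ) ⟨Z₀ᶜ, hZ₀c.isOpen_compl⟩⟩,
      Motives.AlgPoints.isOpen_setOf_pt_mem (X := Xbar) (L := ℂ) W₀⟩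
  rintro _ ⟨b, rfl⟩
  obtain ⟨a, rfl⟩ := hsurj b
  refine ⟨a, ?_⟩
  have hfac : ι ≫ i = ι₀ ≫ i₀ ≫ w₀ := by
    rw [hsq, ← Category.assoc, hι₀]
  change complexBetti.map (ι ≫ i) k a = complexBetti.map (ι₀ ≫ i₀) k (complexBetti.map w₀ k a)
  rw [hfac, ← Category.assoc, complexBetti.map_comp, ModuleCat.comp_apply]

end SNC

/-- **Voisin II, Prop. 4.23 from its simple-normal-crossings core.** The named fact
`voisin2003_rangeRestrict_eq_of_compactification` follows from the inclusion
`Im(ι^* : Hᵏ(𝒳(ℂ); ℂ) → Hᵏ(Y(ℂ); ℂ)) ⊆ Im((ι ≫ i)^* : Hᵏ(X'(ℂ); ℂ) → Hᵏ(Y(ℂ); ℂ))` in the special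
case (`hSNC`) where the compactification `X'` is a smooth projective VARIETY (geometrically
irreducible, of dimension `m`) and the complement of the open immersion `i : 𝒳 ⟶ X'` is the union
`⋃ⱼ V(Dⱼ)` of an injective finite family `D : Fin r → IdealSheafData X'` whose strata
`V(Σ_{j ∈ I} Dⱼ)` are all smooth over `ℂ` of relative dimension `m - |I|` — a simple normal
crossings compactification of `𝒳`, the setting of Deligne's logarithmic complex (Hodge II, §3.1–3.2)
— with `ι : Y ⟶ 𝒳` a closed immersion from a smooth projective variety of dimension `n`, for every
`k`. Assembly: complex coefficients suffice (`voisin2003_rangeRestrict_eq_of_compactification_of_complex`),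
`𝒳̄` may be taken irreducible (`range_complexBetti_map_le_of_irreducible`), and an irreducible `𝒳̄`
is dominated by a log resolution of `𝒳̄ ∖ 𝒳` with the same pure part
(`range_complexBetti_map_le_of_snc`). What remains for the discharge
`voisin2003_rangeRestrict_eq_of_compactification_holds` is exactly `hSNC`: Deligne's mixed Hodge
structure on `Hᵏ(𝒳(ℂ))` by the logarithmic de Rham complex of `(X', ⋃ⱼ V(Dⱼ))`, `W_k = Im i^*`, and
strictness of `ι^*`. [cite: VoisinHodgeII2003, Prop. 4.23] [cite: DeligneHodgeII1971, Thm. 3.2.5 and Cor. 3.2.17]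
[cite: Kollar2007, Thm. 3.21 (p. 124)] [cite: VoisinHodgeI2002, Thm. 7.31 (proof)] -/
theorem voisin2003_rangeRestrict_eq_of_compactification_of_snc
    (hSNC : ∀ (𝒳 X' Y : Motives.SchemeOver ℂ) (i : 𝒳 ⟶ X') (ι : Y ⟶ 𝒳) (m n r : ℕ)
      (D : Fin r → X'.left.IdealSheafData),
      Motives.IsSmoothProjective m X' → IsOpenImmersion i.left → Motives.IsSmoothProjective n Y →
      IsClosedImmersion ι.left → Function.Injective D →
      (∀ I : Finset (Fin r),
        SmoothOfRelativeDimension (m - I.card) ((⨆ j ∈ I, D j).subschemeι ≫ X'.hom)) →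
      (Set.range i.left.base)ᶜ = ⋃ j, ((D j).support : Set X'.left) →
      ∀ k : ℕ, LinearMap.range (complexBetti.map ι k).hom ≤
        LinearMap.range (complexBetti.map (ι ≫ i) k).hom) :
    voisin2003_rangeRestrict_eq_of_compactification := by
  refine voisin2003_rangeRestrict_eq_of_compactification_of_complex
    fun 𝒳 Xbar Y i ι m n hXbar hXs hi hY hι k ↦ ?_
  haveI := hXs
  haveI := hi
  haveI := hι
  exact range_complexBetti_map_le_of_irreducible
    (fun 𝒳₁ X₁ Y₁ i₁ ι₁ m₁ n₁ hX₁ hi₁ hY₁ hι₁ k₁ ↦ by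
      haveI := hi₁
      haveI := hι₁
      exact range_complexBetti_map_le_of_snc hSNC hX₁ i₁ ι₁ hY₁ k₁)
    (m := m) hXbar i ι hY k

/-! ### The Hodge-theoretic mechanism of the printed proof, in the weak form the snc case needs

Voisin's three-line proof ("`Im α = Im α ∩ W₀Hᵏ(Y) = α(W₀Hᵏ(U)) = α(j^*Hᵏ(X))`") is strictness
of the morphism of mixed Hodge structures `ι^* : Hᵏ(U) → Hᵏ(Y)` with PURE target (Deligne, Hodge
II, Thm. 2.3.5 (iii); Voisin II, Thm. 4.20). Unwinding the proof of strictness through Deligne's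
splitting shows that much less than a mixed Hodge structure on `Hᵏ(U)` is used: an increasing
filtration `W` of `Hᵏ(U; ℂ)` (not necessarily rational), exhaustive, whose step `W_k` restricts
into the image of `Hᵏ(X̄)`, and a filtration `F` of `Hᵏ(U; ℂ)` restricting into the Hodge
filtration of `Y`, such that for every `m > k` the graded piece `W_m / W_{m-1}` is SPANNED by the
classes of vectors of "type `(p, m - p)`" — vectors of `F^p ∩ W_m` congruent modulo `W_{m-1}` to a
vector of `conj F^{m-p} ∩ W_m` (the spanning half of "`Gr^W_m` is pure of weight `m`"; neither
directness of the pieces, nor anything about `Gr^W_k`, nor rationality of `W` is needed). The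
theorem below records this criterion on abstract pure Hodge structures (the tree's
`Motives.HodgeStructure`, filtration form); it is the algebraic half of the remaining snc case
(`hSNC` of `voisin2003_rangeRestrict_eq_of_compactification_of_snc`), whose geometric half is the
construction of such `W`, `F` on `Hᵏ(𝒳(ℂ); ℂ)` from the logarithmic de Rham complex of the snc pair
(Deligne, Hodge II, 3.1.5, 3.2.2). -/

section Criterion

open Motives (HodgeStructure MixedHodgeStructure)
open Motives.HodgeStructure (conj complexConj mem_complexConj conj_baseChange ofRat ofRat_apply)
open scoped TensorProduct

universe u' v' w'

variable {V : Type u'} [AddCommGroup V] [Module ℚ V]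
variable {VX : Type v'} [AddCommGroup VX] [Module ℚ VX]
variable {VY : Type w'} [AddCommGroup VY] [Module ℚ VY]

/-- In a pure Hodge structure of weight `n`, `F^p ∩ conj F^q = 0` as soon as `p + q > n`
(`F^p ⊆ F^{n+1-q}`, which is a complement of `conj F^q`; Deligne, Hodge II, 1.2.5).
[cite: DeligneHodgeII1971, 1.2.5] -/
theorem _root_.Literature.AlgebraicGeometry.Motives.HodgeStructure.F_inf_complexConj_F_eq_bot_of_lt
    {n : ℤ} (H : HodgeStructure V n) {p q : ℤ} (h : n < p + q) :
    H.F p ⊓ complexConj (H.F q) = ⊥ := by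
  have h1 := (H.isCompl_F_complexConj (n + 1 - q) q (by ring)).inf_eq_bot
  refine le_bot_iff.mp (le_trans ?_ h1.le)
  exact inf_le_inf_right _ (H.antitone_F (show n + 1 - q ≤ p by omega))

/-- **The image of a filtered map into a pure Hodge structure is the image of its lowest weight
step, as soon as the higher graded pieces are spanned by Hodge-type vectors** (the mechanism of
Deligne, Hodge II, Thm. 2.3.5 (iii) / Voisin II, Thm. 4.20 and proof of Prop. 4.23, in weak form).
Let `H_X → H_Y` be a morphism `f` of pure `ℚ`-Hodge structures of weight `k` (in Prop. 4.23:
`(ι ≫ i)^* : Hᵏ(X̄) → Hᵏ(Y)`), `φ : V → V_Y` a `ℚ`-linear map (`ι^* : Hᵏ(U) → Hᵏ(Y)`), and `W`, `F`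
families of `ℂ`-subspaces of `V_ℂ` with: `φ_ℂ(W_k) ⊆ im f_ℂ` (`hWk`: `W_k Hᵏ(U) = Im Hᵏ(X̄)`),
`φ_ℂ(F^p) ⊆ F^p H_Y` (`hF`), `W_{k+N} = V_ℂ` (`hN`), and for every `m > k` (`hP`)
`W_m ⊆ W_{m-1} + Σ_p (F^p ∩ W_m ∩ (conj F^{m-p} ∩ W_m + W_{m-1}))`. Then `im φ ⊆ im f`.
Proof: by induction on `m`, `φ_ℂ(W_m) ⊆ im f_ℂ`: a vector `x ∈ F^p ∩ W_m` with `x = y + w`,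
`y ∈ conj F^{m-p} ∩ W_m`, `w ∈ W_{m-1}`, maps in the cokernel Hodge structure `H_Y / im f` (pure
of weight `k`, the tree's `HodgeStructure.Hom.cokernel`) into `F^p ∩ conj F^{m-p} = 0`
(`p + (m - p) > k`), i.e. `φ_ℂ x ∈ im f_ℂ`; finally `im φ_ℂ ⊆ im f_ℂ = (im f)_ℂ` descends to `ℚ`
(`HodgeStructure.mem_of_ofRat_mem_baseChange`). [cite: DeligneHodgeII1971, Thm. 2.3.5 (iii)]
[cite: VoisinHodgeII2003, Thm. 4.20 and Prop. 4.23 (proof)] -/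
theorem range_le_range_of_hodgeType_span_gr {k : ℤ} {HX : HodgeStructure VX k}
    {HY : HodgeStructure VY k} (f : HodgeStructure.Hom HX HY) (φ : V →ₗ[ℚ] VY)
    (W F : ℤ → Submodule ℂ (ℂ ⊗[ℚ] V))
    (hWk : (W k).map (φ.baseChange ℂ) ≤ LinearMap.range (f.toLinearMap.baseChange ℂ))
    (hF : ∀ p, (F p).map (φ.baseChange ℂ) ≤ HY.F p)
    (hP : ∀ m, k < m →
      W m ≤ W (m - 1) ⊔ ⨆ p : ℤ, F p ⊓ W m ⊓ (complexConj (F (m - p)) ⊓ W m ⊔ W (m - 1)))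
    {N : ℕ} (hN : W (k + N) = ⊤) :
    LinearMap.range φ ≤ LinearMap.range f.toLinearMap := by
  -- the cokernel `V_Y / im f`, pure of weight `k`, and `ker (π_ℂ) = im f_ℂ`
  have hker : LinearMap.ker ((LinearMap.range f.toLinearMap).mkQ.baseChange ℂ) =
      LinearMap.range (f.toLinearMap.baseChange ℂ) :=
    ker_mkQ_baseChange_eq_range f.toLinearMap
  -- induction on the weight: `φ_ℂ(W_{k+j}) ⊆ im f_ℂ`
  have key : ∀ j : ℕ, (W (k + j)).map (φ.baseChange ℂ) ≤
      LinearMap.range (f.toLinearMap.baseChange ℂ) := by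
    intro j
    induction j with
    | zero => simpa using hWk
    | succ j ih =>
      have hm : k < k + ((j + 1 : ℕ) : ℤ) := by push_cast; omega
      have hm1 : k + ((j + 1 : ℕ) : ℤ) - 1 = k + (j : ℤ) := by push_cast; ring
      refine (Submodule.map_mono (hP _ hm)).trans ?_
      rw [hm1, Submodule.map_sup, sup_le_iff, Submodule.map_iSup, iSup_le_iff]
      refine ⟨ih, fun p ↦ ?_⟩
      rintro _ ⟨x, hx, rfl⟩
      obtain ⟨hx1, hx2⟩ := Submodule.mem_inf.1 hx
      obtain ⟨hxF, -⟩ := Submodule.mem_inf.1 hx1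
      obtain ⟨y, hy, w, hw, rfl⟩ := Submodule.mem_sup.1 hx2
      obtain ⟨hyc, -⟩ := Submodule.mem_inf.1 hy
      -- `φ_ℂ w ∈ im f_ℂ`, `φ_ℂ (y + w) ∈ F^p`, `φ_ℂ y ∈ conj F^{m-p}`
      have hw' : φ.baseChange ℂ w ∈ LinearMap.range (f.toLinearMap.baseChange ℂ) :=
        ih (Submodule.mem_map_of_mem hw)
      have h1 : φ.baseChange ℂ (y + w) ∈ HY.F p := hF p (Submodule.mem_map_of_mem hxF)
      have h2 : φ.baseChange ℂ y ∈ complexConj (HY.F (k + ((j + 1 : ℕ) : ℤ) - p)) := by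
        rw [mem_complexConj, conj_baseChange]
        exact hF _ (Submodule.mem_map_of_mem ((mem_complexConj).1 hyc))
      -- in the cokernel Hodge structure the class lies in `F^p ∩ conj F^{m-p} = 0`
      rw [← hker, LinearMap.mem_ker]
      have hq1 : (LinearMap.range f.toLinearMap).mkQ.baseChange ℂ (φ.baseChange ℂ (y + w)) ∈
          f.cokernel.F p := by
        rw [HodgeStructure.Hom.cokernel_F]
        exact Submodule.mem_map_of_mem h1
      have hyw : (LinearMap.range f.toLinearMap).mkQ.baseChange ℂ (φ.baseChange ℂ (y + w)) =
          (LinearMap.range f.toLinearMap).mkQ.baseChange ℂ (φ.baseChange ℂ y) := by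
        have hw0 : (LinearMap.range f.toLinearMap).mkQ.baseChange ℂ (φ.baseChange ℂ w) = 0 := by
          rw [← LinearMap.mem_ker, hker]
          exact hw'
        rw [map_add, map_add, hw0, add_zero]
      have hq2 : (LinearMap.range f.toLinearMap).mkQ.baseChange ℂ (φ.baseChange ℂ (y + w)) ∈
          complexConj (f.cokernel.F (k + ((j + 1 : ℕ) : ℤ) - p)) := by
        rw [hyw, HodgeStructure.Hom.cokernel_F, complexConj_map_baseChange_eq]
        exact Submodule.mem_map_of_mem h2
      have hbot := f.cokernel.F_inf_complexConj_F_eq_bot_of_lt (p := p)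
        (q := k + ((j + 1 : ℕ) : ℤ) - p) (by omega)
      have hmem : (LinearMap.range f.toLinearMap).mkQ.baseChange ℂ (φ.baseChange ℂ (y + w)) ∈
          f.cokernel.F p ⊓ complexConj (f.cokernel.F (k + ((j + 1 : ℕ) : ℤ) - p)) := ⟨hq1, hq2⟩
      rw [hbot] at hmem
      exact (Submodule.mem_bot ℂ).1 hmem
  -- conclude over `ℚ`: `im φ_ℂ ⊆ im f_ℂ = (im f)_ℂ`
  rintro _ ⟨u, rfl⟩
  have h : φ.baseChange ℂ (ofRat u) ∈ LinearMap.range (f.toLinearMap.baseChange ℂ) :=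
    key N (Submodule.mem_map_of_mem (by rw [hN]; exact Submodule.mem_top))
  rw [MixedHodgeStructure.range_baseChange] at h
  refine HodgeStructure.mem_of_ofRat_mem_baseChange _ ?_
  have hu : ofRat (φ u) = φ.baseChange ℂ (ofRat u) := by
    rw [ofRat_apply, ofRat_apply, LinearMap.baseChange_tmul]
  rw [hu]
  exact h

/-- **The spanning hypothesis `hP` of `range_le_range_of_hodgeType_span_gr` for the complement of
ONE smooth divisor, from liftability of residues inside `F`.** When the boundary `D = X̄ ∖ U` is a
smooth divisor the weight filtration of `Hᵏ(U)` has two steps, `W_k = Im Hᵏ(X̄) = ker Res` and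
`W_{k+1} = Hᵏ(U)`, where `Res : Hᵏ(U) → H^{k-1}(D)(-1)` is the residue of the Thom–Gysin sequence
`Hᵏ(X̄) → Hᵏ(U) →^{Res} H^{k-1}(D) →^{i_*} H^{k+1}(X̄)` (Voisin II, §6.1.1; Deligne, Hodge II,
3.1.9 and 3.2.13 (ii)); `Gr^W_{k+1} Hᵏ(U) ≅ Im Res = ker i_*` is a sub-Hodge structure `S` of
the pure `H^{k-1}(D)(-1)` of weight `k + 1` (`HD`; `i_*` is a morphism of Hodge structures). In
this situation the spanning of `Gr^W_{k+1}` by Hodge-type vectors follows from the **lifting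
property** `hL`: every residue of type `F^p` is the residue of a class in `F^p Hᵏ(U)` — for a
vector `x`, decompose `Res x = Σ_p ξ_p` into its components `ξ_p ∈ S_ℂ ∩ H^{p, k+1-p}` (the
tree's `SubHodgeStructure.baseChange_le_iSup_inf`), lift `ξ_p` inside `F^p` and, conjugating a lift
of `conj ξ_p` inside `F^{k+1-p}` (`Res` is real), also inside `conj F^{k+1-p}`; the two lifts
differ by an element of `ker Res_ℂ = (ker Res)_ℂ`. (For Deligne's `F` — classes of logarithmic
forms with `≥ p` holomorphic differentials — `hL` is the `∂∂̄`-lemma on `X̄` applied to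
`d(η ∧ dz/z)`, Hodge II 3.2.) [cite: DeligneHodgeII1971, 3.1.9, 3.2.13 (ii) and Thm. 2.3.5]
[cite: VoisinHodgeII2003, §6.1.1 and Prop. 4.23] -/
theorem hodgeType_span_gr_of_residue_lifts {k : ℤ} {VD : Type v'} [AddCommGroup VD] [Module ℚ VD]
    {HD : HodgeStructure VD (k + 1)} (S : HodgeStructure.SubHodgeStructure HD)
    (Res : V →ₗ[ℚ] VD) (hS : S.toSubmodule = LinearMap.range Res)
    (F : ℤ → Submodule ℂ (ℂ ⊗[ℚ] V))
    (hL : ∀ (p : ℤ), ∀ ξ ∈ HD.F p ⊓ LinearMap.range (Res.baseChange ℂ),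
      ∃ x ∈ F p, Res.baseChange ℂ x = ξ)
    (W : ℤ → Submodule ℂ (ℂ ⊗[ℚ] V)) (hWk : W k = (LinearMap.ker Res).baseChange ℂ)
    (hWgt : ∀ m, k < m → W m = ⊤) :
    ∀ m, k < m →
      W m ≤ W (m - 1) ⊔ ⨆ p : ℤ, F p ⊓ W m ⊓ (complexConj (F (m - p)) ⊓ W m ⊔ W (m - 1)) := by
  intro m hm
  by_cases hm1 : k + 1 < m
  · exact le_sup_of_le_left (by rw [hWgt (m - 1) (by omega)]; exact le_top)
  obtain rfl : m = k + 1 := by omega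
  have hkk : k + 1 - 1 = k := by ring
  rw [hkk, hWgt (k + 1) hm, hWk]
  -- the kernel and the range of `Res_ℂ`
  have hker : ∀ z, z ∈ (LinearMap.ker Res).baseChange ℂ ↔ Res.baseChange ℂ z = 0 :=
    HodgeStructure.mem_baseChange_ker_iff Res
  have hrange : S.toSubmodule.baseChange ℂ = LinearMap.range (Res.baseChange ℂ) := by
    rw [hS, MixedHodgeStructure.range_baseChange]
  set T : Submodule ℂ (ℂ ⊗[ℚ] V) := (LinearMap.ker Res).baseChange ℂ ⊔ ⨆ p : ℤ,
    F p ⊓ ⊤ ⊓ (complexConj (F (k + 1 - p)) ⊓ ⊤ ⊔ (LinearMap.ker Res).baseChange ℂ) with hT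
  have hkerT : ∀ z, Res.baseChange ℂ z = 0 → z ∈ T := fun z hz ↦
    Submodule.mem_sup_left ((hker z).2 hz)
  -- every vector with residue in `Σ_p (S_ℂ ∩ H^{p,k+1-p})` lies in `T`
  have key : ∀ ξ ∈ ⨆ p : ℤ, S.toSubmodule.baseChange ℂ ⊓ HD.piece p (k + 1 - p),
      ξ ∈ LinearMap.range (Res.baseChange ℂ) ∧ ∀ x, Res.baseChange ℂ x = ξ → x ∈ T := by
    intro ξ hξ
    refine Submodule.iSup_induction _
      (motive := fun ξ ↦ ξ ∈ LinearMap.range (Res.baseChange ℂ) ∧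
        ∀ x, Res.baseChange ℂ x = ξ → x ∈ T) hξ (fun p ξ hξp ↦ ?_) ?_ (fun ξ₁ ξ₂ h₁ h₂ ↦ ?_)
    · obtain ⟨hξS, hξpiece⟩ := Submodule.mem_inf.1 hξp
      have hξr : ξ ∈ LinearMap.range (Res.baseChange ℂ) := by rwa [← hrange]
      have hξF : ξ ∈ HD.F p := HD.piece_le_F p _ hξpiece
      have hξc : conj ξ ∈ HD.F (k + 1 - p) :=
        (mem_complexConj).1 (HD.piece_le_complexConj_F p _ hξpiece)
      -- a lift inside `F^p`
      obtain ⟨xp, hxpF, hxp⟩ := hL p ξ ⟨hξF, hξr⟩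
      -- a lift inside `conj F^{k+1-p}`: conjugate a lift of `conj ξ`
      have hξr' : conj ξ ∈ LinearMap.range (Res.baseChange ℂ) :=
        ⟨conj xp, by rw [← conj_baseChange, hxp]⟩
      obtain ⟨yp, hypF, hyp⟩ := hL (k + 1 - p) (conj ξ) ⟨hξc, hξr'⟩
      have hyp' : Res.baseChange ℂ (conj yp) = ξ := by
        rw [← conj_baseChange, hyp, HodgeStructure.conj_conj]
      have hxT : xp ∈ T := by
        refine Submodule.mem_sup_right (Submodule.mem_iSup_of_mem p ?_)
        refine Submodule.mem_inf.2 ⟨Submodule.mem_inf.2 ⟨hxpF, Submodule.mem_top⟩, ?_⟩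
        have hsplit : xp = conj yp + (xp - conj yp) := by abel
        rw [hsplit]
        refine Submodule.add_mem_sup (Submodule.mem_inf.2 ⟨?_, Submodule.mem_top⟩) ((hker _).2 ?_)
        · rw [mem_complexConj, HodgeStructure.conj_conj]
          exact hypF
        · rw [map_sub, hxp, hyp', sub_self]
      refine ⟨hξr, fun x hx ↦ ?_⟩
      have hsplit : x = xp + (x - xp) := by abel
      rw [hsplit]
      exact T.add_mem hxT (hkerT _ (by rw [map_sub, hx, hxp, sub_self]))
    · exact ⟨zero_mem _, fun x hx ↦ hkerT x hx⟩
    · obtain ⟨⟨x₁, hx₁⟩, h₁T⟩ := h₁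
      obtain ⟨h₂r, h₂T⟩ := h₂
      refine ⟨add_mem ⟨x₁, hx₁⟩ h₂r, fun x hx ↦ ?_⟩
      have hsplit : x = x₁ + (x - x₁) := by abel
      rw [hsplit]
      exact T.add_mem (h₁T x₁ hx₁) (h₂T _ (by rw [map_sub, hx, hx₁, add_sub_cancel_left]))
  -- conclude: the residue of any vector decomposes into Hodge components inside `S_ℂ`
  intro x _
  have hx : Res.baseChange ℂ x ∈ ⨆ p : ℤ, S.toSubmodule.baseChange ℂ ⊓ HD.piece p (k + 1 - p) :=
    S.baseChange_le_iSup_inf (by rw [hrange]; exact ⟨x, rfl⟩)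
  exact (key _ hx).2 x rfl

/-- **Prop. 4.23 for the complement of one smooth divisor, reduced to its four inputs** (assembly
of `range_le_range_of_hodgeType_span_gr` and `hodgeType_span_gr_of_residue_lifts`). For
`Y →ι U →j X̄` with `X̄ ∖ U = D` a smooth divisor, writing `f = (ι ≫ j)^* : Hᵏ(X̄) → Hᵏ(Y)`
(a morphism of pure Hodge structures of weight `k`), `φ = ι^* : Hᵏ(U) → Hᵏ(Y)`,
`Res : Hᵏ(U) → H^{k-1}(D)(-1)` and `F^p ⊆ Hᵏ(U; ℂ)`: if (1) `φ_ℂ((ker Res)_ℂ) ⊆ im f_ℂ`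
(Thom–Gysin exactness `ker Res = Im j^*`, Voisin II §6.1.1), (2) `Im Res` underlies a sub-Hodge
structure of `H^{k-1}(D)(-1)` (it is `ker i_*`, `i_*` a morphism of Hodge structures), (3)
`φ_ℂ(F^p) ⊆ F^p Hᵏ(Y)` and (4) residues of type `F^p` lift inside `F^p` (`hL`), then
`Im ι^* ⊆ Im (ι ≫ j)^*`. [cite: VoisinHodgeII2003, Prop. 4.23 and §6.1.1]
[cite: DeligneHodgeII1971, 3.2.13 (ii) and Thm. 2.3.5 (iii)] -/
theorem range_le_range_of_residue_lifts {k : ℤ} {HX : HodgeStructure VX k}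
    {HY : HodgeStructure VY k} (f : HodgeStructure.Hom HX HY) (φ : V →ₗ[ℚ] VY)
    {VD : Type v'} [AddCommGroup VD] [Module ℚ VD] {HD : HodgeStructure VD (k + 1)}
    (S : HodgeStructure.SubHodgeStructure HD) (Res : V →ₗ[ℚ] VD)
    (hS : S.toSubmodule = LinearMap.range Res) (F : ℤ → Submodule ℂ (ℂ ⊗[ℚ] V))
    (hWk : ((LinearMap.ker Res).baseChange ℂ).map (φ.baseChange ℂ) ≤
      LinearMap.range (f.toLinearMap.baseChange ℂ))
    (hF : ∀ p, (F p).map (φ.baseChange ℂ) ≤ HY.F p)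
    (hL : ∀ (p : ℤ), ∀ ξ ∈ HD.F p ⊓ LinearMap.range (Res.baseChange ℂ),
      ∃ x ∈ F p, Res.baseChange ℂ x = ξ) :
    LinearMap.range φ ≤ LinearMap.range f.toLinearMap := by
  set W : ℤ → Submodule ℂ (ℂ ⊗[ℚ] V) := fun m ↦
    if m ≤ k then (LinearMap.ker Res).baseChange ℂ else ⊤ with hW
  have hWk' : W k = (LinearMap.ker Res).baseChange ℂ := if_pos le_rfl
  have hWgt : ∀ m, k < m → W m = ⊤ := fun m hm ↦ if_neg (not_le.2 hm)
  refine range_le_range_of_hodgeType_span_gr f φ W F (by rw [hWk']; exact hWk) hF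
    (hodgeType_span_gr_of_residue_lifts S Res hS F hL W hWk' hWgt) (N := 1) ?_
  exact hWgt _ (by push_cast; omega)

/-- **The transposed (Gysin) form of the mechanism, in the weak form a "principle of two types"
proof would establish.** By Poincaré duality on `Y` and Poincaré–Lefschetz duality
`Hᵏ(U) ≅ H^{2n-k}(X̄, D)^∨`, Prop. 4.23 is equivalent to: a class `y ∈ H^{2d-k}(Y)` whose Gysin
image `(ι ≫ j)_! y` vanishes in `H^m(X̄)`, `m = 2n - k`, already has vanishing Gysin image with
supports `ι_! y ∈ H^m_c(U) = H^m(X̄, D)` (Deligne, Hodge III, 8.2.8: "la suite transposée par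
dualité de Poincaré"). In mixed-Hodge terms: `ι_!` is a morphism from the pure `H^{2d-k}(Y)(d-n)`
(weight `m`) and `ker(H^m(X̄, D) → H^m(X̄)) = Im(H^{m-1}(D) → H^m(X̄, D))` has weights `≤ m - 1`.
The abstract statement below records what this uses: `ψ : V_Y → T` (`ι_!`) shifting Hodge types by
`(c, c)` into a filtration `F` of `T_ℂ` (`hψ`), `π : T → T'` (`H^m(X̄, D) → H^m(X̄)`) with
`ker (π ∘ ψ)` a sub-Hodge structure of the pure `H_Y` of weight `n` (`hK`; `π ∘ ψ = (ι ≫ j)_!` is a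
morphism of Hodge structures), and the vanishing `F^p ∩ conj F^q ∩ (ker π)_ℂ = 0` for
`p + q = n + 2c` (`hvan`: no vector of Hodge type of total weight `m` dies in `H^m(X̄)` — the
content a types-proof must supply, cf. the tree's `StrataClassVanishing` for Hodge III 8.2.7);
then `ker (π ∘ ψ) ⊆ ker ψ`. [cite: DeligneHodgeIII1974, Prop. 8.2.7 and Cor. 8.2.8]
[cite: DeligneHodgeII1971, Thm. 2.3.5 (iii)] [cite: VoisinHodgeII2003, Prop. 4.23] -/
theorem ker_comp_le_ker_of_hodgeType_vanishing {n c : ℤ} {HY : HodgeStructure VY n}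
    {T : Type u'} [AddCommGroup T] [Module ℚ T] {T' : Type v'} [AddCommGroup T'] [Module ℚ T']
    (ψ : VY →ₗ[ℚ] T) (π : T →ₗ[ℚ] T') (F : ℤ → Submodule ℂ (ℂ ⊗[ℚ] T))
    (K : HodgeStructure.SubHodgeStructure HY) (hK : K.toSubmodule = LinearMap.ker (π ∘ₗ ψ))
    (hψ : ∀ p : ℤ, (HY.piece p (n - p)).map (ψ.baseChange ℂ) ≤ F (p + c))
    (hvan : ∀ p q : ℤ, p + q = n + 2 * c →
      F p ⊓ complexConj (F q) ⊓ (LinearMap.ker π).baseChange ℂ = ⊥) :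
    LinearMap.ker (π ∘ₗ ψ) ≤ LinearMap.ker ψ := by
  intro y hy
  -- `ψ_ℂ` kills every Hodge component of `ker (π ∘ ψ)_ℂ`
  have key : ∀ z ∈ ⨆ p : ℤ, K.toSubmodule.baseChange ℂ ⊓ HY.piece p (n - p),
      ψ.baseChange ℂ z = 0 := by
    intro z hz
    refine Submodule.iSup_induction _ (motive := fun z ↦ ψ.baseChange ℂ z = 0) hz
      (fun p z hzp ↦ ?_) (map_zero _) (fun z₁ z₂ h₁ h₂ ↦ by rw [map_add, h₁, h₂, add_zero])
    obtain ⟨hzK, hzpiece⟩ := Submodule.mem_inf.1 hzp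
    -- `ψ_ℂ z ∈ (ker π)_ℂ`
    have h1 : ψ.baseChange ℂ z ∈ (LinearMap.ker π).baseChange ℂ := by
      rw [HodgeStructure.mem_baseChange_ker_iff]
      rw [hK, HodgeStructure.mem_baseChange_ker_iff, LinearMap.baseChange_comp] at hzK
      exact hzK
    -- `ψ_ℂ z ∈ F^{p+c}` and `conj (ψ_ℂ z) = ψ_ℂ (conj z) ∈ F^{n-p+c}`
    have h2 : ψ.baseChange ℂ z ∈ F (p + c) := hψ p (Submodule.mem_map_of_mem hzpiece)
    have h3 : ψ.baseChange ℂ z ∈ complexConj (F (n - p + c)) := by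
      rw [mem_complexConj, conj_baseChange]
      have hconj : conj z ∈ HY.piece (n - p) (n - (n - p)) := by
        rw [sub_sub_cancel]
        exact HY.conj_mem_piece hzpiece
      exact hψ (n - p) (Submodule.mem_map_of_mem hconj)
    have hbot := hvan (p + c) (n - p + c) (by ring)
    have hmem : ψ.baseChange ℂ z ∈
        F (p + c) ⊓ complexConj (F (n - p + c)) ⊓ (LinearMap.ker π).baseChange ℂ :=
      ⟨⟨h2, h3⟩, h1⟩
    rw [hbot] at hmem
    exact (Submodule.mem_bot ℂ).1 hmem
  -- apply it to `1 ⊗ y`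
  have hy' : ofRat y ∈ K.toSubmodule.baseChange ℂ := by
    rw [ofRat_apply]
    exact Submodule.tmul_mem_baseChange_of_mem 1 (by rw [hK]; exact hy)
  have h0 : ψ.baseChange ℂ (ofRat y) = 0 := key _ (K.baseChange_le_iSup_inf hy')
  rw [LinearMap.mem_ker]
  apply HodgeStructure.ofRat_injective (V := T)
  rw [map_zero, ofRat_apply, ← LinearMap.baseChange_tmul, ← ofRat_apply]
  exact h0

/-- **A real linear map killing every Hodge component of a sub-Hodge structure kills it.** For a
sub-Hodge structure `K ⊆ H_Y` (pure of weight `n`) and a `ℚ`-linear `ψ : V_Y → T`, if `ψ_ℂ`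
vanishes on `K_ℂ ∩ H^{p, n-p}` for every `p` then `K ⊆ ker ψ` (`K_ℂ = ⊕_p K_ℂ ∩ H^{p,n-p}`,
`SubHodgeStructure.baseChange_le_iSup_inf`, and `V ↪ ℂ ⊗ V`). This is the reduction of the
transposed form of Prop. 4.23 (`ker (ι ≫ j)_* ⊆ ker ι_*` on `H_k`, see
`voisin2003_rangeRestrict_eq_of_compactification_of_homology`) to classes of PURE Hodge type:
`K = PD_Y⁻¹(ker (ι ≫ j)_*) = ker (ι ≫ j)_!` is a sub-Hodge structure of `H^{2d-k}(Y)` (the Gysin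
morphism is a morphism of Hodge structures) and `ψ = ι_* ∘ PD_Y`.
[cite: VoisinHodgeI2002, §7.3.1 Def. 7.24] [cite: DeligneHodgeIII1974, Cor. 8.2.8] -/
theorem _root_.Literature.AlgebraicGeometry.Motives.HodgeStructure.SubHodgeStructure.le_ker_of_piece
    {n : ℤ} {HY : HodgeStructure VY n} (K : HodgeStructure.SubHodgeStructure HY)
    {T : Type u'} [AddCommGroup T] [Module ℚ T] (ψ : VY →ₗ[ℚ] T)
    (h : ∀ p : ℤ, ∀ z ∈ K.toSubmodule.baseChange ℂ ⊓ HY.piece p (n - p), ψ.baseChange ℂ z = 0) :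
    K.toSubmodule ≤ LinearMap.ker ψ := by
  intro y hy
  have key : ∀ z ∈ ⨆ p : ℤ, K.toSubmodule.baseChange ℂ ⊓ HY.piece p (n - p),
      ψ.baseChange ℂ z = 0 := fun z hz ↦
    Submodule.iSup_induction _ (motive := fun z ↦ ψ.baseChange ℂ z = 0) hz h (map_zero _)
      (fun z₁ z₂ h₁ h₂ ↦ by rw [map_add, h₁, h₂, add_zero])
  have hy' : ofRat y ∈ K.toSubmodule.baseChange ℂ := by
    rw [ofRat_apply]
    exact Submodule.tmul_mem_baseChange_of_mem 1 hy
  rw [LinearMap.mem_ker]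
  apply HodgeStructure.ofRat_injective (V := T)
  rw [map_zero, ofRat_apply, ← LinearMap.baseChange_tmul, ← ofRat_apply]
  exact key _ (K.baseChange_le_iSup_inf hy')

end Criterion

/-! ### The residue in homological form

By the duality between singular cohomology and homology over a field
(`range_singularCohomology_map_le_iff_of_field`: `Im f^* ⊆ Im g^*` iff `ker g_* ⊆ ker f_*`) and
the change of coefficients `ℚ ↦ ℂ`, the snc core `hSNC` of
`voisin2003_rangeRestrict_eq_of_compactification_of_snc` is equivalently the statement printed by
Voisin right after Prop. 4.23 in its homological reading: **a rational `k`-cycle of `Y(ℂ)` which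
bounds in `X̄(ℂ)` already bounds in `U(ℂ)`** — `ker((ι ≫ i)_*) ⊆ ker(ι_*)` on `H_k(Y(ℂ); ℚ)` —
for `Y →ι U →i X̄` with `X̄` smooth projective, `X̄ ∖ U` a simple normal crossings boundary and
`Y` smooth projective (Deligne, Hodge III, 8.2.8: "la suite transposée par dualité de Poincaré").
With Poincaré duality on `Y(ℂ)` (`H_k(Y) ≅ H^{2d-k}(Y)`, under which `(ι ≫ i)_*` becomes the Gysin
morphism, a morphism of Hodge structures, so that its kernel is a sub-Hodge structure) and
`SubHodgeStructure.le_ker_of_piece`, it is enough to treat classes of pure Hodge type `(a, b)` on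
`Y`; the Hodge-theoretic content is then that the boundary obstruction in
`H_{k+1}(X̄, U) / H_{k+1}(X̄) ≅ H^{2n-k-1}(D) / Im H^{2n-k-1}(X̄)` of such a class vanishes
(currents of pure type and the principle of two types on the strata of `D`, or Deligne's weights). -/

section Homology

/-- **Prop. 4.23 from its homological snc core**: if for all `Y →ι 𝒳 →i X'` as in
`voisin2003_rangeRestrict_eq_of_compactification_of_snc` (smooth projective `X'`, open immersion
`i` with simple normal crossings complement, closed immersion `ι` from a smooth projective `Y`)
every class of `H_k(Y(ℂ); ℚ)` killed by `(ι ≫ i)(ℂ)_*` is killed by `ι(ℂ)_*` (`hH`), the named fact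
holds: over `ℚ`, `ker (ι ≫ i)_* ⊆ ker ι_*` is `Im ι^* ⊆ Im (ι ≫ i)^*`
(`range_singularCohomology_map_le_iff_of_field`), which ascends to `ℂ`-coefficients
(`singularCohomology.range_map_le_range_map_of_algebra`) and feeds
`voisin2003_rangeRestrict_eq_of_compactification_of_snc`. [cite: VoisinHodgeII2003, Prop. 4.23]
[cite: DeligneHodgeIII1974, Cor. 8.2.8] [cite: HatcherAT2002, §3.1 Thm. 3.2 and §3.A Cor. 3A.4] -/
theorem voisin2003_rangeRestrict_eq_of_compactification_of_homology
    (hH : ∀ (𝒳 X' Y : Motives.SchemeOver ℂ) (i : 𝒳 ⟶ X') (ι : Y ⟶ 𝒳) (m n r : ℕ)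
      (D : Fin r → X'.left.IdealSheafData),
      Motives.IsSmoothProjective m X' → IsOpenImmersion i.left → Motives.IsSmoothProjective n Y →
      IsClosedImmersion ι.left → Function.Injective D →
      (∀ I : Finset (Fin r),
        SmoothOfRelativeDimension (m - I.card) ((⨆ j ∈ I, D j).subschemeι ≫ X'.hom)) →
      (Set.range i.left.base)ᶜ = ⋃ j, ((D j).support : Set X'.left) →
      ∀ k : ℕ, LinearMap.ker (singularHomology.map ℚ ℚ
          (Motives.AlgPoints.mapContinuous (L := ℂ) (ι ≫ i)) k).hom ≤
        LinearMap.ker (singularHomology.map ℚ ℚ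
          (Motives.AlgPoints.mapContinuous (L := ℂ) ι) k).hom) :
    voisin2003_rangeRestrict_eq_of_compactification :=
  voisin2003_rangeRestrict_eq_of_compactification_of_snc
    fun 𝒳 X' Y i ι m n r D hX' hi hY hι hD hS hc k ↦
      singularCohomology.range_map_le_range_map_of_algebra ℚ (L := ℂ) _ _ k
        ((range_singularCohomology_map_le_iff_of_field ℚ _ _ k).2
          (hH 𝒳 X' Y i ι m n r D hX' hi hY hι hD hS hc k))

end Homology

/-! ### The residue on classes of pure Hodge type

Poincaré duality on the closed oriented manifold `Y(ℂ)` (the tree's theorem `poincare_duality`,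
through `OrientationFamily.hasPoincareDuality`) writes every class of `H_k(Y(ℂ); ℂ)` as
`u ⌢ [Y(ℂ)]`, `u ∈ H^{2n-k}(Y(ℂ); ℂ)`; the Hodge decomposition of `Y` (a Hodge model,
`nonempty_hodgeModel_holds`) splits `u` into classes of pure type `(p, q)`; and the kernel of
`(ι ≫ i)(ℂ)_* ∘ PD_Y = PD_{X'} ∘ (ι ≫ i)_*` (`capProduct_complexGysin`) is spanned by its pure-type
members, because the Gysin morphism `(ι ≫ i)_*` has bidegree `(m - n, m - n)` on Hodge types
(`isOfHodgeType_complexGysin`, Voisin I §7.3.2, from the tree's theorems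
`hodgePQ_independent_of_hodgeModel_holds` and de Rham's theorem `exists_deRhamIsoFamily_holds`)
and the Hodge pieces of `X'` are independent (field `HodgeModel.isInternal_hodgePQ`). So the
homological snc core `hH` needs checking only on classes `u ⌢ [Y(ℂ)]` with `u` of pure Hodge
type — the input a "principle of two types" argument on `(X', D)` would produce. -/

section PureType

open Literature.NumberTheory.Transcendental (exists_deRhamIsoFamily exists_deRhamIsoFamily_holds)

/-- Elements of a zero object of `ModuleCat` vanish. [folklore] -/
private theorem eq_zero_of_isZero {M : ModuleCat.{v} ℂ} (h : Limits.IsZero M) (x : M) : x = 0 := by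
  have h1 : (𝟙 M : M ⟶ M) = 0 := h.eq_of_src _ _
  have h2 := congrArg (fun φ : M ⟶ M ↦ φ.hom x) h1
  simpa using h2

/-- A finite sum of vectors taken in independent submodules vanishes only if every term does.
[folklore] -/
private theorem eq_zero_of_sum_eq_zero_of_iSupIndep {κ : Type*} {R N : Type*} [Ring R]
    [AddCommGroup N] [Module R N] {T : κ → Submodule R N} (hT : iSupIndep T) (s : Finset κ)
    (v : κ → N) (hv : ∀ i ∈ s, v i ∈ T i) (h0 : ∑ i ∈ s, v i = 0) : ∀ i ∈ s, v i = 0 := by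
  classical
  induction s using Finset.induction_on with
  | empty => simp
  | insert j s hj ih =>
    rw [Finset.sum_insert hj] at h0
    have hvj : v j ∈ T j := hv j (Finset.mem_insert_self j s)
    have hrest : ∑ i ∈ s, v i ∈ ⨆ i ∈ (s : Set κ), T i :=
      Submodule.sum_mem_biSup fun i hi ↦ hv i (Finset.mem_insert_of_mem hi)
    have hdisj : Disjoint (T j) (⨆ i ∈ (s : Set κ), T i) :=
      hT.disjoint_biSup (fun h ↦ hj (Finset.mem_coe.1 h))
    have hvj' : v j ∈ ⨆ i ∈ (s : Set κ), T i := by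
      rw [eq_neg_of_add_eq_zero_left h0]
      exact Submodule.neg_mem _ hrest
    have hj0 : v j = 0 := (Submodule.disjoint_def.1 hdisj) _ hvj hvj'
    rw [hj0, zero_add] at h0
    intro i hi
    rcases Finset.mem_insert.1 hi with rfl | hi
    · exact hj0
    · exact ih (fun i hi ↦ hv i (Finset.mem_insert_of_mem hi)) h0 i hi

/-- **Prop. 4.23 from its homological snc core on classes of pure Hodge type.** Fix an
orientation family `μ` (`ℂ`-orientations of the closed manifolds `X(ℂ)`, `X` smooth projective).
Suppose that for all `Y →ι 𝒳 →i X'` as in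
`voisin2003_rangeRestrict_eq_of_compactification_of_snc` and every class `u ∈ Hᵃ(Y(ℂ); ℂ)` OF
PURE HODGE TYPE `(p, q)`, `a + k = 2 dim Y`, whose Poincaré dual `u ⌢ [Y(ℂ)]_μ ∈ H_k(Y(ℂ); ℂ)`
dies under `(ι ≫ i)(ℂ)_*`, the class `u ⌢ [Y(ℂ)]_μ` already dies under `ι(ℂ)_*` (`hT`). Then the
named fact holds: over `ℂ` every `z ∈ H_k(Y(ℂ))` is `u ⌢ [Y(ℂ)]` (Poincaré duality; `H_k = 0`
for `k > 2 dim Y`), `u = Σ u_{p,q}` (Hodge decomposition), and `(ι ≫ i)(ℂ)_* (u ⌢ [Y]) =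
((ι ≫ i)_* u) ⌢ [X']` with `(ι ≫ i)_* u_{p,q}` of the distinct types `(p + m - n, q + m - n)`
(`dim Y = n ≤ m = dim X'`, `ι ≫ i` being an immersion), so that `(ι ≫ i)_* u = 0` forces
`(ι ≫ i)_* u_{p,q} = 0` for every `(p, q)`; `hT` then kills each `ι(ℂ)_* (u_{p,q} ⌢ [Y])`, and
the inclusion of kernels descends from `ℂ` to `ℚ`
(`singularHomology.ker_map_le_ker_map_descent_of_algebra`) to feed
`voisin2003_rangeRestrict_eq_of_compactification_of_homology`. [cite: VoisinHodgeII2003, Prop. 4.23]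
[cite: VoisinHodgeI2002, §7.3.2 (with Lemma 7.30)] [cite: HatcherAT2002, §3.3 Thm. 3.30]
[cite: DeligneHodgeIII1974, Cor. 8.2.8] -/
theorem voisin2003_rangeRestrict_eq_of_compactification_of_pureType (μ : OrientationFamily)
    (hT : ∀ (𝒳 X' Y : Motives.SchemeOver ℂ) (i : 𝒳 ⟶ X') (ι : Y ⟶ 𝒳) (m n r : ℕ)
      (D : Fin r → X'.left.IdealSheafData) (hX' : Motives.IsSmoothProjective m X')
      (hY : Motives.IsSmoothProjective n Y),
      IsOpenImmersion i.left → IsClosedImmersion ι.left → Function.Injective D →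
      (∀ I : Finset (Fin r),
        SmoothOfRelativeDimension (m - I.card) ((⨆ j ∈ I, D j).subschemeι ≫ X'.hom)) →
      (Set.range i.left.base)ᶜ = ⋃ j, ((D j).support : Set X'.left) →
      ∀ (a k p q : ℕ) (hak : a + k = 2 * n), p + q = a → ∀ u : complexBetti Y a,
        IsOfHodgeType n Y a p q u →
        singularHomology.map ℂ ℂ (Motives.AlgPoints.mapContinuous (L := ℂ) (ι ≫ i)) k
            (capProduct hak u (μ hY).fundamentalClass) = 0 →
        singularHomology.map ℂ ℂ (Motives.AlgPoints.mapContinuous (L := ℂ) ι) k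
            (capProduct hak u (μ hY).fundamentalClass) = 0) :
    voisin2003_rangeRestrict_eq_of_compactification := by
  refine voisin2003_rangeRestrict_eq_of_compactification_of_homology
    fun 𝒳 X' Y i ι m n r D hX' hi hY hι hD hS hc k ↦ ?_
  -- descend from `ℂ` to `ℚ`
  refine singularHomology.ker_map_le_ker_map_descent_of_algebra ℚ (L := ℂ) _ _ k ?_
  intro z hz
  rw [LinearMap.mem_ker] at hz ⊢
  change singularHomology.map ℂ ℂ (Motives.AlgPoints.mapContinuous (L := ℂ) (ι ≫ i)) k z = 0 at hz
  change singularHomology.map ℂ ℂ (Motives.AlgPoints.mapContinuous (L := ℂ) ι) k z = 0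
  -- degrees above `2 dim Y`: `H_k(Y(ℂ)) = 0`
  by_cases hk : 2 * n < k
  · rw [eq_zero_of_isZero (Motives.ComplexPoints.isZero_singularHomology_of_lt hY ℂ ℂ hk) z,
      map_zero]
  obtain ⟨a, hak⟩ : ∃ a, a + k = 2 * n := ⟨2 * n - k, by omega⟩
  -- Poincaré duality on `Y(ℂ)`: `z = u ⌢ [Y(ℂ)]`
  obtain ⟨u, rfl⟩ := (μ.hasPoincareDuality hY hak).2 z
  rw [poincareDualityMap_apply] at hz ⊢
  -- Hodge decomposition of `u` in a Hodge model `A` of `Y`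
  obtain ⟨A⟩ := nonempty_hodgeModel_holds (n := n) (X := Y) hY
  obtain ⟨w, hwsum, hw⟩ := A.exists_sum_eq_of_hodgeDecomposition a u
  -- each component is killed by `(ι ≫ i)(ℂ)_* ∘ PD_Y`
  have hcomp : ∀ pq ∈ Finset.HasAntidiagonal.antidiagonal a,
      singularHomology.map ℂ ℂ (Motives.AlgPoints.mapContinuous (L := ℂ) (ι ≫ i)) k
        (capProduct hak (w pq) (μ hY).fundamentalClass) = 0 := by
    by_cases hkm : 2 * m < k
    · exact fun pq _ ↦
        eq_zero_of_isZero (Motives.ComplexPoints.isZero_singularHomology_of_lt hX' ℂ ℂ hkm) _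
    obtain ⟨b, hbk⟩ : ∃ b, b + k = 2 * m := ⟨2 * m - k, by omega⟩
    have hab : a + 2 * m = b + 2 * n := by omega
    -- `dim Y ≤ dim X'`: `ι ≫ i` is an immersion
    have hnm : n ≤ m := by
      haveI := hi
      haveI := hι
      haveI : IsIntegral Y.left := Motives.IsSmoothProjective.isIntegral_holds hY
      haveI : IsIntegral X'.left := Motives.IsSmoothProjective.isIntegral_holds hX'
      haveI := hY.smoothOfRelativeDimension
      haveI := hX'.smoothOfRelativeDimension
      have h1 := Motives.topologicalKrullDim_eq_of_smoothOfRelativeDimension Y.hom n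
      have h2 := Motives.topologicalKrullDim_eq_of_smoothOfRelativeDimension X'.hom m
      have hind : Topology.IsInducing (i.left.base ∘ ι.left.base) :=
        i.left.isOpenEmbedding.isInducing.comp ι.left.isClosedEmbedding.isInducing
      have h3 := hind.topologicalKrullDim_le
      rw [h1, h2] at h3
      exact_mod_cast h3
    -- the Gysin morphism `g = (ι ≫ i)_*` and its defining square
    set g := complexGysin μ hY hX' (ι ≫ i) hab with hg
    have hsq : ∀ y, capProduct hbk (g y) (μ hX').fundamentalClass =
        singularHomology.map ℂ ℂ (Motives.AlgPoints.mapContinuous (L := ℂ) (ι ≫ i)) k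
          (capProduct hak y (μ hY).fundamentalClass) :=
      fun y ↦ capProduct_complexGysin μ.hasPoincareDuality hY hX' (ι ≫ i) hab hak hbk y
    -- `g u = 0` (Poincaré duality on `X'(ℂ)`)
    have hgu : g u = 0 := by
      apply (μ.hasPoincareDuality hX' hbk).1
      rw [poincareDualityMap_apply, poincareDualityMap_apply, hsq, hz, map_zero,
        LinearMap.zero_apply]
    -- the components `g (w pq)` have distinct Hodge types in a model `B` of `X'`
    obtain ⟨B⟩ := nonempty_hodgeModel_holds (n := m) (X := X') hX'
    have hI := hodgePQ_independent_of_hodgeModel_holds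
    have htyp : ∀ pq ∈ Finset.HasAntidiagonal.antidiagonal a,
        B.pullback b (g (w pq)) ∈ B.hodgePQ b (pq.1 + m - n) (pq.2 + m - n) := by
      intro pq hpq
      have hy : IsOfHodgeType n Y a pq.1 pq.2 (w pq) := ⟨A, hw pq hpq⟩
      have h := isOfHodgeType_complexGysin hI (fun m Y ↦ nonempty_hodgeModel_holds)
        (fun E _ _ _ ↦ exists_deRhamIsoFamily_holds E) μ hY hX' (ι ≫ i) hab
        (p' := pq.1 + m - n) (q' := pq.2 + m - n) (by omega) (by omega) hy
      exact (hI.isOfHodgeType_iff hX' B).1 h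
    -- de Rham side: representatives in the independent pieces `H^{p',q'}(X'^an)`
    set e := B.deRham B.carrier b with he
    have hrep : ∀ pq ∈ Finset.HasAntidiagonal.antidiagonal a, ∃ v,
        v ∈ Literature.NumberTheory.Transcendental.hodgePQ B.model B.carrier b
          (pq.1 + m - n) (pq.2 + m - n) ∧ e.toLinearMap v = B.pullback b (g (w pq)) :=
      fun pq hpq ↦ Submodule.mem_map.1 (htyp pq hpq)
    choose! v hv using hrep
    -- reindex by the antidiagonal of `b`
    let κ := ↥(Finset.HasAntidiagonal.antidiagonal a)
    let φ : κ → ↥(Finset.HasAntidiagonal.antidiagonal b) := fun pq ↦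
      ⟨(pq.1.1 + m - n, pq.1.2 + m - n), by
        have := Finset.HasAntidiagonal.mem_antidiagonal.1 pq.2
        exact Finset.HasAntidiagonal.mem_antidiagonal.2 (by omega)⟩
    have hφ : Function.Injective φ := by
      rintro ⟨⟨p₁, q₁⟩, h₁⟩ ⟨⟨p₂, q₂⟩, h₂⟩ h
      have h' := congrArg Subtype.val h
      simp only [φ, Prod.mk.injEq] at h'
      have := Finset.HasAntidiagonal.mem_antidiagonal.1 h₁
      have := Finset.HasAntidiagonal.mem_antidiagonal.1 h₂
      exact Subtype.ext (Prod.ext (by simp only; omega) (by simp only; omega))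
    have hind : iSupIndep fun pq : κ ↦
        Literature.NumberTheory.Transcendental.hodgePQ B.model B.carrier b (φ pq).1.1 (φ pq).1.2 :=
      (B.isInternal_hodgePQ b).submodule_iSupIndep.comp hφ
    -- the sum of the representatives vanishes
    have hsum0 : ∑ pq : κ, v pq.1 = 0 := by
      apply e.injective
      rw [map_sum, map_zero, Finset.sum_coe_sort (Finset.HasAntidiagonal.antidiagonal a) (fun pq ↦ e (v pq))]
      have h1 : ∑ pq ∈ Finset.HasAntidiagonal.antidiagonal a, e (v pq) =
          ∑ pq ∈ Finset.HasAntidiagonal.antidiagonal a, B.pullback b (g (w pq)) :=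
        Finset.sum_congr rfl fun pq hpq ↦ (hv pq hpq).2
      rw [h1]
      change ∑ pq ∈ Finset.HasAntidiagonal.antidiagonal a, (B.pullback b).hom (g (w pq)) = 0
      rw [← map_sum, ← map_sum, hwsum, hgu, map_zero]
    have hv0 : ∀ pq : κ, v pq.1 = 0 := fun pq ↦
      eq_zero_of_sum_eq_zero_of_iSupIndep hind Finset.univ (fun pq : κ ↦ v pq.1)
        (fun pq _ ↦ (hv pq.1 pq.2).1) hsum0 pq (Finset.mem_univ pq)
    -- hence every `g (w pq)` vanishes, and so does `(ι ≫ i)(ℂ)_* (w pq ⌢ [Y])`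
    intro pq hpq
    have hgw : g (w pq) = 0 := by
      apply B.pullback_injective b
      rw [← (hv pq hpq).2, hv0 ⟨pq, hpq⟩, map_zero, map_zero]
    rw [← hsq, hgw, map_zero, LinearMap.zero_apply]
  -- conclude with `hT` on each pure-type component
  rw [← hwsum, map_sum, LinearMap.sum_apply]
  change (singularHomology.map ℂ ℂ (Motives.AlgPoints.mapContinuous (L := ℂ) ι) k).hom
      (∑ pq ∈ Finset.HasAntidiagonal.antidiagonal a, capProduct hak (w pq) (μ hY).fundamentalClass) = 0
  rw [map_sum]
  refine Finset.sum_eq_zero fun pq hpq ↦ ?_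
  exact hT 𝒳 X' Y i ι m n r D hX' hY hi hι hD hS hc a k pq.1 pq.2 hak
    (Finset.HasAntidiagonal.mem_antidiagonal.1 hpq) (w pq) ⟨A, hw pq hpq⟩ (hcomp pq hpq)

/-- **Prop. 4.23 from vanishing of periods of pure-type classes.** In the situation of
`voisin2003_rangeRestrict_eq_of_compactification_of_pureType`, the conclusion
`ι(ℂ)_* (u ⌢ [Y(ℂ)]) = 0` in `H_k(𝒳(ℂ); ℂ)` is, by the universal coefficient theorem over the field
`ℂ` (`kroneckerPairing_surjective`: `Hᵏ(𝒳(ℂ); ℂ) ↠ Hom(H_k(𝒳(ℂ); ℂ), ℂ)`), the vanishing of the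
PERIODS `⟨u ∪ ι^* α, [Y(ℂ)]⟩` for all `α ∈ Hᵏ(𝒳(ℂ); ℂ)` (`⟨α, ι_* (u ⌢ [Y])⟩ = ⟨ι^* α, u ⌢ [Y]⟩ =
⟨u ∪ ι^* α, [Y]⟩`, `kroneckerPairing_map`, `kroneckerPairing_cupProduct`), and likewise the
hypothesis `(ι ≫ i)(ℂ)_* (u ⌢ [Y(ℂ)]) = 0` gives `⟨u ∪ (ι ≫ i)^* β, [Y(ℂ)]⟩ = 0` for all
`β ∈ Hᵏ(X'(ℂ); ℂ)`. So the named fact follows from (`hK`): for `u ∈ Hᵃ(Y(ℂ); ℂ)` of pure Hodge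
type `(p, q)`, `a + k = 2 dim Y`, if `∫_Y u ∪ (ι ≫ i)^* β = 0` for every class `β` of the smooth
projective `X'`, then `∫_Y u ∪ ι^* α = 0` for every class `α` of the open `𝒳 = X' ∖ D` — read
through de Rham's theorem, a statement about closed `k`-forms on `𝒳(ℂ)` integrated against a
harmonic `(p, q)`-form on `Y(ℂ)`. [cite: VoisinHodgeII2003, Prop. 4.23]
[cite: HatcherAT2002, §3.1 Thm. 3.2 and §3.3 p. 241] -/
theorem voisin2003_rangeRestrict_eq_of_compactification_of_periods (μ : OrientationFamily)
    (hK : ∀ (𝒳 X' Y : Motives.SchemeOver ℂ) (i : 𝒳 ⟶ X') (ι : Y ⟶ 𝒳) (m n r : ℕ)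
      (D : Fin r → X'.left.IdealSheafData) (hX' : Motives.IsSmoothProjective m X')
      (hY : Motives.IsSmoothProjective n Y),
      IsOpenImmersion i.left → IsClosedImmersion ι.left → Function.Injective D →
      (∀ I : Finset (Fin r),
        SmoothOfRelativeDimension (m - I.card) ((⨆ j ∈ I, D j).subschemeι ≫ X'.hom)) →
      (Set.range i.left.base)ᶜ = ⋃ j, ((D j).support : Set X'.left) →
      ∀ (a k p q : ℕ) (hak : a + k = 2 * n), p + q = a → ∀ u : complexBetti Y a,
        IsOfHodgeType n Y a p q u →
        (∀ β : complexBetti X' k, kroneckerPairing ℂ ℂ (Motives.ComplexPoints Y) (2 * n)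
            (cupProduct hak u (complexBetti.map (ι ≫ i) k β)) (μ hY).fundamentalClass = 0) →
        ∀ α : complexBetti 𝒳 k, kroneckerPairing ℂ ℂ (Motives.ComplexPoints Y) (2 * n)
            (cupProduct hak u (complexBetti.map ι k α)) (μ hY).fundamentalClass = 0) :
    voisin2003_rangeRestrict_eq_of_compactification := by
  refine voisin2003_rangeRestrict_eq_of_compactification_of_pureType μ
    fun 𝒳 X' Y i ι m n r D hX' hY hi hι hD hS hc a k p q hak hpq u hu h0 ↦ ?_
  -- test against `Hᵏ(𝒳(ℂ); ℂ) ↠ Hom(H_k(𝒳(ℂ); ℂ), ℂ)`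
  refine (Module.forall_dual_apply_eq_zero_iff ℂ _).1 fun φ ↦ ?_
  obtain ⟨α, rfl⟩ := kroneckerPairing_surjective ℂ (Motives.ComplexPoints 𝒳) k φ
  rw [← kroneckerPairing_map, ← kroneckerPairing_cupProduct]
  refine hK 𝒳 X' Y i ι m n r D hX' hY hi hι hD hS hc a k p q hak hpq u hu (fun β ↦ ?_) α
  change kroneckerPairing ℂ ℂ (Motives.ComplexPoints Y) (2 * n) (cupProduct hak u
    (singularCohomology.map ℂ ℂ (Motives.AlgPoints.mapContinuous (L := ℂ) (ι ≫ i)) k β))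
    (μ hY).fundamentalClass = 0
  rw [kroneckerPairing_cupProduct, kroneckerPairing_map, h0, map_zero]

end PureType

end Literature.AlgebraicGeometry.HodgeTheory

end
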